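import Literature.NumberTheory.ConnesConsani2021.ArchimedeanTraceFormula
import Literature.NumberTheory.ConnesConsani2021.ScalingOperator
import Literature.NumberTheory.ConnesConsani2021.SchwartzKernels
import Literature.NumberTheory.ConnesConsani2021.ProlateProjections
import Literature.NumberTheory.ConnesConsani2021.ProlateProjectionsProofs
import Literature.NumberTheory.ConnesConsani2021.SoninTraceReduction
import Literature.NumberTheory.ConnesConsani2021.ProlateTraceIdentities
import Literature.NumberTheory.ConnesConsani2021.ProlateProjectionsCompleteness
import Literature.NumberTheory.LFunctions.WeilExplicitArchParitySech
import Literature.Analysis.Convolution.DixmierMalliavin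
import HarnessLib

/-!
# Connes–Consani 2021, Theorem 4.7 — proof layer: the symmetric extension, the termwise
# integration of (chirem3) `δ(ρ) = Σ λ(n)²⟨ζ_n|ϑ(ρ⁻¹)ζ_n⟩ + ε(ρ)` against a test function, and the
# assembly of the weak Theorem 4.7 (route item K1) from the named facts of §2 and §4

RH-FREE proof bookkeeping (cell `rh-crit`, sub-cell cc, seat t4; bears_on W-C/W-P, apex input (A)).
WHAT THIS IS NOT: any claim about RH; nothing here bears on the truth of RH.  No definition, no named
fact (net debt 0).

A. Connes, C. Consani, *Weil positivity and trace formula, the archimedean place*, Selecta Math.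
(N.S.) 27 (2021) 77 = arXiv:2006.13771 [bib: `ConnesConsani2021`], §4, proof of Thm. 4.7 (= arXiv
Thm. 27, chunk p0018:L42–87).  After the pointwise identity (chirem3) (p0018:L71–73) "for `ρ ≥ 1`,
`δ(ρ) = Σ λ(n)²⟨ζ_n|ϑ(ρ⁻¹)ζ_n⟩ + ε(ρ)`", the printed proof continues (p0018:L75–78): "Since both `δ`,
`ε` and the terms `⟨ζ_n|ϑ(ρ⁻¹)ζ_n⟩` are invariant under `ρ ↦ ρ⁻¹`, we thus obtain, for any test function
`f ∈ C_c^∞(ℝ₊*)`, `∫ f(ρ⁻¹)δ(ρ)d*ρ = ∫ f(ρ⁻¹)ε(ρ)d*ρ + Σ λ(n)²⟨ζ_n|ϑ(f)ζ_n⟩`."  This file kernel-checks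
exactly these two steps, generically in the data of (chirem3) — a real sequence `μ` (in print
`λ(n)²`), vectors `χ_n ∈ L²(ℝ)` (in print the `ζ_n = ψ_n/(1 − λ(n)²)^{1/2}` of Prop. 4.5 (iii), real valued) with
`Σ |μ_n| ‖χ_n‖² < ∞` (in print `Σ λ(n)² = δ(1) < ∞`, Rem. 4.6 (i), and `‖ζ_n‖ = 1`), the tree's
`traceRemainder = δ` and `remainderD = D` (`SchwartzKernels.lean`, seat t1) and `epsDensity = ε ∘ exp`,
`evenFunctional (epsDensity ψ) = E` (`ArchimedeanTraceFormula.lean`):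

* `re_scalingCoeff_self_neg`, `im_scalingCoeff_self_of_conj`, `scalingCoeff_self_neg_of_conj` —
  with the tree's `norm_scalingCoeff_le`, `scalingCoeff_neg`, `continuous_scalingCoeff`
  (`SemilocalTwist.lean`): matrix coefficients `⟨ξ|ϑ(e^τ)η⟩` are bounded by `‖ξ‖‖η‖`, satisfy
  `⟨ξ|ϑ(e^{−τ})η⟩ = conj⟨η|ϑ(e^{τ})ξ⟩` (unitarity), are continuous in `τ`, and are real and even on the
  diagonal for a real-valued vector ("the terms `⟨ζ_n|ϑ(ρ⁻¹)ζ_n⟩` are invariant under `ρ ↦ ρ⁻¹`", "the `ξ_n, ψ_n` are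
  real valued", Prop. 4.5 (iii)/(iv), Rem. 4.6 (ii));
* `hasSum_chirem3_of_nonpos` — the SYMMETRIC EXTENSION: (chirem3) for `ρ ≥ 1` (additively: `t ≤ 0`,
  `⟨ζ|ϑ(ρ⁻¹)ζ⟩ = scalingCoeff ζ ζ t` at `ρ = e^{−t}`) gives it for all `t`, by `δ(ρ⁻¹) = δ(ρ)`
  (`traceRemainder_inv`), `ε(ρ⁻¹) = ε(ρ)` (`epsDensity_neg`) and the evenness of the diagonal
  coefficients of real vectors;
* `hasSum_integral_mul_of_summable_bound` — TERMWISE INTEGRATION (dominated convergence for series,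
  Mathlib `hasSum_integral_of_dominated_convergence`) of a pointwise summable series of continuous
  functions with summable sup-bounds against an `L¹` weight;
* `hasSum_chirem3_of_chirem1` / `hasSum_chirem3_of_chirem1'`, `thm_4_7_footnote` — the ALGEBRA of the
  printed proof (p0018:L45–73): (chirem1) + (hattrick) + (sym1) + the footnote identity
  `λ√(1−λ²) + λ²·λ/√(1−λ²) = λ/√(1−λ²)` give (chirem3), the `ε`-series converging because
  `Σ λ(n)²⟨ζ_n|ϑ(ρ⁻¹)ζ_n⟩` does;
* `hasSum_soninTraceForm_of_chirem3` / `hasSum_re_soninTraceForm_of_chirem3` — the integrated identity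
  "`∫ f(ρ⁻¹)δ(ρ)d*ρ = ∫ f(ρ⁻¹)ε(ρ)d*ρ + Σ λ(n)²⟨ζ_n|ϑ(f)ζ_n⟩`" in the tree's typing:
  `HasSum (n ↦ μ_n · soninTraceForm k χ_n) (remainderD k − evenFunctional (epsDensity ψ) k)` for every
  test function `k` (and its real-part form for `k = g ∗ g*`, which is LITERALLY hypothesis (hA) of
  `ScalingOperator.sum_re_soninTraceForm_le_of_decomposition`, the O4a bridge that assembles the weak
  Theorem 4.7 / route item K1 from Prop. 2.2 (iii), eq. (spectral) and this).

* `hasSum_chirem3_prolate`, `hasSum_re_soninTraceForm_prolate` (section `ProlateFamily`) — the same for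
  THE prolate family `prolateFun` of `ProlateProjections.lean` (seat t3), whose named facts
  `CC2021_prop_4_5_ii` (chirem1), `CC2021_prop_4_5_iii` (`ψ_n` real, `‖ψ_n‖ = (1 − λ²)^{1/2}`),
  `CC2021_prop_4_5_iv` (hattrick), `CC2021_rem_4_6_i` (`Σλ(n)² = δ(1)`), `CC2021_rem_4_6_ii` (sym1) and
  `CC2021_sec4_lambda_basic` (`|λ(n)| < 1`) are EXACTLY the hypotheses; with the tree's
  `integrable_traceRemainder_exp` (seat t1, proved) nothing else enters.  So (hA) is reduced to printed,
  typed §4 statements; (hL) is Prop. 2.2 (iii) (seat t1) and (hC)/(hQ) are eq. (spectral) (seat t3).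

* `hasSum_chirem3_prolate_of` — the core of the previous item with the MINIMAL printed inputs as
  hypotheses; `norm_prolateZeta_eq_one` (`‖ζ_n‖ = 1`), `prolateZeta_conj_ae'` (`ζ_n` real a.e.),
  `hasSum_chirem3_prolate'`, `hasSum_re_soninTraceForm_prolate'` — (chirem3) and (hA) from THREE named
  facts only (`CC2021_prop_4_5_ii`, `CC2021_prop_4_5_iv`, `CC2021_rem_4_6_i`), the other printed inputs
  ((sym1), `ψ_n` real, `‖ψ_n‖`, `|λ(n)| < 1`) being seat t3's DISCHARGED theorems
  (`ProlateProjectionsProofs.lean`: `CC2021_rem_4_6_ii_holds`, `conj_prolatePsiFun`, `norm_prolatePsi`,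
  `abs_prolateEigen_lt_one`).

* `CC2021_thm_4_7_weak_of_traces` / `CC2021_thm_4_7_weak_of_traces'` (section `Assembly`) — **Theorem
  4.7's weak form = route item K1, ASSEMBLED modulo operator inputs**: from seat t3's §4 facts (through
  (hA); six, resp. three) and, as hypotheses in the exact shapes of the O4a bridge
  `sum_re_soninTraceForm_le_of_decomposition`, (hC)/(hQ) = eq. (spectral) as quadratic forms and
  (hL) = Prop. 2.2 (iii) in Hilbert–Schmidt form; the printed last step
  `L − A = (W_∞ + D) − (D − E) = W_∞ + E` (p0018:L79–87).
* `CC2021_thm_4_7_weak_of_sec2_sec4` — **Theorem 4.7's weak form (= K1) FROM FIVE NAMED FACTS AND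
  NOTHING ELSE**: `CC2021_prop_2_2_iii` (seat t1), `CC2021_prop_4_5_spectral`, `CC2021_prop_4_5_ii`,
  `CC2021_prop_4_5_iv`, `CC2021_rem_4_6_i` (seat t3); the operator side is O4a's
  `SoninTraceReduction.soninTrace_partial_le_archW_add_of_spectral` (Sonin projections
  `soninProjection 1 0`, `soninProjection 0 1`, which carry the evenness; `traceL = archW + remainderD`),
  the §4 side is `hasSum_re_soninTraceForm_prolate'`, and `IsArchDensity.evenFunctional_eq` passes
  from `ε ∘ exp` to any archimedean density `G`.  `weilArchPositivity_soninTrace_fine_of_sec2_sec4_of_opIneq`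
  delivers it as the (H-TF) binder of `MainInequalityAssembly` (through the statement file's adapter).
* `CC2021_thm_4_7_weak_of_prop_2_2_iii_of_xi_complete` — **Theorem 4.7's weak form (= K1) FROM THE TWO
  BOUNDARY FACTS OF RECORD**: `CC2021_prop_2_2_iii` (Prop. 2.2 (iii), `Tr(ϑ(f)PP̂P) = L(f)`) and
  `CC2021_sec4_xi_complete` (completeness of the even prolate basis of `𝒫₁L²(ℝ)_ev`, [Slepian]); the three
  §4 facts `CC2021_prop_4_5_spectral`, `CC2021_prop_4_5_ii`, `CC2021_rem_4_6_i` are fed by row O12's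
  reductions to `CC2021_sec4_xi_complete` (`ProlateTraceIdentities.lean`) and `CC2021_prop_4_5_iv` by seat
  t3's `CC2021_prop_4_5_iv_holds`; `weilArchPositivity_soninTrace_fine_of_prop_2_2_iii_of_xi_complete_of_opIneq`
  is the corresponding (H-TF) delivery.
* `memLp_quantizedDiffKernel` — **App. D Lemma D.1 (= arXiv Lemma 47), first clause, PROVED** (Rem. D.2 (48)'s direct kernel
  estimate, p0033:L39–41): for `f ∈ 𝒮(ℝ)` the kernel `k_f(s,t) = (i/π)(f(s) − f(t))/(s − t)` of
  `[H, f]` is in `L²(ℝ²)`; hence `CC2021_lemma_D47_iff_isInfiniteOrder` (the named fact is now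
  equivalent to its infinite-order clause alone).

* **The STRONG Theorem 4.7 (`CC2021_thm_4_7`, as printed: every test function, every orthonormal basis of
  `S(1,1)`, and the positivity clause)** — sections `StrongAutocorr` … `StrongForm`:
  `hasSum_re_soninTraceForm_sonin[_of_prop_2_2_iii|_of_spectral]` (for `f = g ∗ g*` the identity holds as
  an EQUALITY of convergent sums along EVERY Hilbert basis of `S(1,1)`, via O4a's
  `HilbertSchmidtPartialSums.hasSum_norm_sq_adjoint_of_decomposition`; the weak form had "partial sums ≤");
  `hasSum_soninTraceForm_sonin_autocorr` (complex form) and `archW_add_evenFunctional_autocorr_nonneg`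
  (clause (ii): `W_∞(g ∗ g*) + E(g ∗ g*)` is real — unconditionally: `conj_archW_of_weilReflect_eq`,
  `conj_evenFunctional_of_weilReflect_eq`, `conj_epsDensity` — and `≥ 0`); linearity of `ϑ`, `W_∞`, `E` on
  test functions (`soninTraceForm_add`, `archW_add`, `evenFunctional_add`, `integrable_mul_epsDensity_abs`);
  the polarization identity `u ∗ K = ¼Σ_k i^k (u + i^k K*) ∗ (u + i^k K*)*` (`weilConv_polarization`) and hence
  clause (i) on the span of convolutions of test functions (`hasSum_soninTraceForm_sonin_weilConv`,
  `…_sum_weilConv`); finally `CC2021_thm_4_7_of_sec2_sec4_of_factorization` /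
  `CC2021_thm_4_7_of_prop_2_2_iii_of_xi_complete_of_factorization`: **`CC2021_thm_4_7` from the boundary
  facts of route item K1 (`CC2021_prop_2_2_iii`, `CC2021_sec4_xi_complete`) plus ONE explicit hypothesis,
  the Dixmier–Malliavin factorization `C_c^∞(ℝ) = span C_c^∞(ℝ) ∗ C_c^∞(ℝ)`** ([DixmierMalliavin1978,
  Thm. 3.1] for `G = ℝ`; restated with proof in [Hegde2021, §3]) — no trace-class theory (positivity,
  Hilbert–Schmidt sums, polarization), no named fact introduced.
* Section `OneFact` — after seat t10/t3's `CC2021_sec4_xi_complete_holds` (`ProlateProjectionsCompleteness.lean`: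
  the even prolate basis IS complete), everything above modulo `CC2021_prop_2_2_iii` ALONE:
  `CC2021_thm_4_7_weak_of_prop_2_2_iii` (route item K1 from ONE named fact),
  `weilArchPositivity_soninTrace_fine_of_prop_2_2_iii_of_opIneq`, `hasSum_soninTraceForm_sonin_autocorr'`,
  `archW_add_evenFunctional_autocorr_nonneg'`, and `CC2021_thm_4_7_of_prop_2_2_iii_of_factorization`
  (the strong Theorem 4.7 from `CC2021_prop_2_2_iii` + Dixmier–Malliavin(`ℝ`)).
* Section `DixmierMalliavin` — the factorization hypothesis is the tree's named fact
  `Literature.Analysis.Convolution.DixmierMalliavin_real` ([DixmierMalliavin1978, Thm. 3.1] for `G = ℝ`,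
  file `Literature/Analysis/Convolution/DixmierMalliavin.lean`; its factorization step is PROVED in
  `DixmierMalliavinFactorization.lean`): `isWeilTest_factorization_of_dixmierMalliavin` (the bridge, by
  `rfl`: `IsWeilTest = ContDiff ℝ ∞ ∧ HasCompactSupport`, `weilConv = ⋆[mul ℂ ℂ]`) and
  **`CC2021_thm_4_7_of_dixmierMalliavin : DixmierMalliavin_real → CC2021_prop_2_2_iii → CC2021_thm_4_7`**.

Nothing is assumed about RH or about the numerical values.
-/

noncomputable section

open _root_.MeasureTheory Complex Set Filter FourierTransform
open scoped Real ComplexConjugate InnerProductSpace Topology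

namespace Literature.NumberTheory.ConnesConsani2021

open Literature.NumberTheory.LFunctions Literature.Analysis.OperatorTheory

/-! ## Matrix coefficients of `ϑ`: bound, unitarity symmetry, continuity, realness on the diagonal -/

/-- RH-FREE. The real part of a diagonal coefficient is even in `τ`: `Re⟨χ|ϑ(ρ⁻¹)χ⟩ = Re⟨χ|ϑ(ρ)χ⟩`.
[cite: ConnesConsani2021, Thm. 4.7 proof §4 p. 18 (arXiv chunk p0018:L75)] -/
theorem re_scalingCoeff_self_neg (χ : Lp ℂ 2 (volume : Measure ℝ)) (τ : ℝ) :
    (scalingCoeff χ χ (-τ)).re = (scalingCoeff χ χ τ).re := by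
  rw [scalingCoeff_neg, Complex.conj_re]

/-- RH-FREE. `scalingCoeff` only depends on the a.e. classes of its arguments (dilations preserve
Lebesgue-null sets). [cite: ConnesConsani2021, §4 eq. (40) p. 15] -/
theorem scalingCoeff_congr_ae {u u' v v' : ℝ → ℂ} (hu : u =ᵐ[volume] u') (hv : v =ᵐ[volume] v')
    (τ : ℝ) : scalingCoeff u v τ = scalingCoeff u' v' τ := by
  unfold scalingCoeff
  refine integral_congr_ae ?_
  have hv' := Literature.Analysis.OperatorTheory.ae_eq_comp_smul (V := ℝ) hv (Real.exp_pos (-τ)).ne'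
  filter_upwards [hu, hv'] with x hx hx'
  simp only [smul_eq_mul] at hx'
  rw [hx, hx']

/-- RH-FREE. `scalingCoeff` is linear in the scalar of its second argument:
`⟨u|ϑ(e^τ)(c v)⟩ = c⟨u|ϑ(e^τ)v⟩`. [cite: ConnesConsani2021, §4 eq. (40) p. 15] -/
theorem scalingCoeff_const_mul_right (u v : ℝ → ℂ) (c : ℂ) (τ : ℝ) :
    scalingCoeff u (fun x => c * v x) τ = c * scalingCoeff u v τ := by
  unfold scalingCoeff
  rw [← integral_const_mul]
  refine integral_congr_ae (Eventually.of_forall fun x => ?_)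
  ring

/-- RH-FREE. For a REAL-VALUED vector (`conj χ = χ` a.e.; "the functions `ψ_n` are real valued",
Prop. 4.5 (iii)), the diagonal coefficient `⟨χ|ϑ(e^τ)χ⟩ = ∫ χ̄(v) e^{−τ/2} χ(e^{−τ}v) dv` is real.
[cite: ConnesConsani2021, Prop. 4.5 (iii) §4 p. 16 (arXiv chunk p0016:L56); Rem. 4.6 (ii) p. 18] -/
theorem im_scalingCoeff_self_of_conj {χ : ℝ → ℂ} (hχ : ∀ᵐ v : ℝ, conj (χ v) = χ v) (τ : ℝ) :
    (scalingCoeff χ χ τ).im = 0 := by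
  have hreal : conj (scalingCoeff χ χ τ) = scalingCoeff χ χ τ := by
    rw [scalingCoeff, ← integral_conj]
    refine integral_congr_ae ?_
    have hχ' := Literature.Analysis.OperatorTheory.ae_eq_comp_smul (V := ℝ) hχ (Real.exp_pos (-τ)).ne'
    filter_upwards [hχ, hχ'] with v hv hv'
    simp only [smul_eq_mul] at hv'
    simp only [map_mul, Complex.conj_conj, Complex.conj_ofReal, hv']
    rw [hv]
  exact Complex.conj_eq_iff_im.1 hreal

/-- RH-FREE. Hence for a real-valued vector the diagonal coefficient itself is even:
`⟨χ|ϑ(ρ⁻¹)χ⟩ = ⟨χ|ϑ(ρ)χ⟩` — "the terms `⟨ζ_n|ϑ(ρ⁻¹)ζ_n⟩` are invariant under `ρ ↦ ρ⁻¹`".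
[cite: ConnesConsani2021, Thm. 4.7 proof §4 p. 18 (arXiv chunk p0018:L75)] -/
theorem scalingCoeff_self_neg_of_conj (χ : Lp ℂ 2 (volume : Measure ℝ))
    (hχ : ∀ᵐ v : ℝ, conj ((χ : ℝ → ℂ) v) = (χ : ℝ → ℂ) v) (τ : ℝ) :
    scalingCoeff χ χ (-τ) = scalingCoeff χ χ τ := by
  apply Complex.ext
  · exact re_scalingCoeff_self_neg χ τ
  · rw [im_scalingCoeff_self_of_conj hχ, im_scalingCoeff_self_of_conj hχ]

/-! ## The algebra of the proof of Theorem 4.7: (chirem1) + (hattrick) + (sym1) ⇒ (chirem3) -/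

/-- RH-FREE. `λ(1 − λ²)^{1/2} + λ² · λ(1 − λ²)^{-1/2} = λ(1 − λ²)^{-1/2}` for `−1 < λ < 1` (the footnote
of the proof of Thm. 4.7, p0018:L67: "Note that for `−1 < λ < 1` one has
`λ√(1−λ²) + λ²·λ/√(1−λ²) = λ/√(1−λ²)`"). [cite: ConnesConsani2021, Thm. 4.7 proof §4 p. 18 (arXiv chunk p0018:L67)] -/
theorem thm_4_7_footnote {l : ℝ} (hl : |l| < 1) :
    l * Real.sqrt (1 - l ^ 2) + l ^ 2 * (l / Real.sqrt (1 - l ^ 2)) = l / Real.sqrt (1 - l ^ 2) := by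
  have h1 : 0 < 1 - l ^ 2 := by
    have := abs_lt.1 hl
    nlinarith
  have hs : 0 < Real.sqrt (1 - l ^ 2) := Real.sqrt_pos.2 h1
  have hss : Real.sqrt (1 - l ^ 2) ^ 2 = 1 - l ^ 2 := Real.sq_sqrt h1.le
  field_simp
  rw [hss]
  ring

/-- RH-FREE. **The three-line algebra of the proof of Theorem 4.7** (p0018:L45–73), for ONE `ρ ≥ 1`,
on abstract coefficient sequences: write `A_n = ⟨ξ_n|ϑ(ρ⁻¹)ξ_n⟩`, `B_n = ⟨ξ_n|ϑ(ρ⁻¹)ζ_n⟩`,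
`B′_n = ⟨ζ_n|ϑ(ρ⁻¹)ξ_n⟩`, `C_n = ⟨ζ_n|ϑ(ρ⁻¹)ζ_n⟩`, `τ(n) = λ(n)(1 − λ(n)²)^{-1/2}`.  From
(chirem1) `δ(ρ) = Σ (λ(n)² A_n + λ(n)(1 − λ(n)²)^{1/2} B_n)` (Prop. 4.5 (ii) with `ψ_n = (1 − λ²)^{1/2}ζ_n`),
(hattrick) `A_n = C_n + τ(n)(B_n + B′_n)` (Prop. 4.5 (iv)), (sym1) `B′_n = 0` (Rem. 4.6 (ii)), `|λ(n)| < 1`,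
and the convergence of `ε(ρ) = Σ τ(n) B_n` (App. E), conclude (chirem3):
`Σ λ(n)² C_n = δ(ρ) − ε(ρ)`. [cite: ConnesConsani2021, Thm. 4.7 proof §4 p. 18 (arXiv chunk p0018:L45–73)] -/
theorem hasSum_chirem3_of_chirem1 {ι : Type*} {lam : ι → ℝ} {A B B' C : ι → ℂ} {δρ ερ : ℂ}
    (hlam : ∀ n, |lam n| < 1)
    (h1 : HasSum (fun n => ((lam n ^ 2 : ℝ) : ℂ) * A n
      + ((lam n * Real.sqrt (1 - lam n ^ 2) : ℝ) : ℂ) * B n) δρ)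
    (h4 : ∀ n, A n = C n + ((lam n / Real.sqrt (1 - lam n ^ 2) : ℝ) : ℂ) * (B n + B' n))
    (hsym : ∀ n, B' n = 0)
    (hε : HasSum (fun n => ((lam n / Real.sqrt (1 - lam n ^ 2) : ℝ) : ℂ) * B n) ερ) :
    HasSum (fun n => ((lam n ^ 2 : ℝ) : ℂ) * C n) (δρ - ερ) := by
  have key : ∀ n, ((lam n ^ 2 : ℝ) : ℂ) * A n + ((lam n * Real.sqrt (1 - lam n ^ 2) : ℝ) : ℂ) * B n
      = ((lam n ^ 2 : ℝ) : ℂ) * C n + ((lam n / Real.sqrt (1 - lam n ^ 2) : ℝ) : ℂ) * B n := by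
    intro n
    rw [h4 n, hsym n, add_zero]
    have hf := congrArg (fun r : ℝ => (r : ℂ)) (thm_4_7_footnote (hlam n))
    simp only [Complex.ofReal_add, Complex.ofReal_mul, Complex.ofReal_pow, Complex.ofReal_div] at hf ⊢
    linear_combination (B n) * hf
  simp_rw [key] at h1
  have h := h1.sub hε
  simp_rw [add_sub_cancel_right] at h
  exact h

/-- RH-FREE. **Variant of the algebra with the convergence of `ε` DERIVED rather than assumed**: under
(chirem1), (hattrick), (sym1) and `|λ(n)| < 1`, if `Σ λ(n)² C_n` converges (in print: `|C_n| =
|⟨ζ_n|ϑ(ρ⁻¹)ζ_n⟩| ≤ 1` and `Σ λ(n)² = δ(1) < ∞`, Rem. 4.6 (i)), then the series (sonine0)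
`ε(ρ) = Σ τ(n) B_n` converges, to `δ(ρ) − Σ λ(n)² C_n`, and (chirem3) holds:
`Σ λ(n)² C_n = δ(ρ) − ε(ρ)`. [cite: ConnesConsani2021, Thm. 4.7 proof §4 p. 18 (arXiv chunk p0018:L45–73)] -/
theorem hasSum_chirem3_of_chirem1' {ι : Type*} {lam : ι → ℝ} {A B B' C : ι → ℂ} {δρ : ℂ}
    (hlam : ∀ n, |lam n| < 1)
    (h1 : HasSum (fun n => ((lam n ^ 2 : ℝ) : ℂ) * A n
      + ((lam n * Real.sqrt (1 - lam n ^ 2) : ℝ) : ℂ) * B n) δρ)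
    (h4 : ∀ n, A n = C n + ((lam n / Real.sqrt (1 - lam n ^ 2) : ℝ) : ℂ) * (B n + B' n))
    (hsym : ∀ n, B' n = 0) (hC : Summable fun n => ((lam n ^ 2 : ℝ) : ℂ) * C n) :
    HasSum (fun n => ((lam n / Real.sqrt (1 - lam n ^ 2) : ℝ) : ℂ) * B n)
        (δρ - ∑' n, ((lam n ^ 2 : ℝ) : ℂ) * C n) ∧
      HasSum (fun n => ((lam n ^ 2 : ℝ) : ℂ) * C n)
        (δρ - ∑' n, ((lam n / Real.sqrt (1 - lam n ^ 2) : ℝ) : ℂ) * B n) := by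
  have key : ∀ n, ((lam n ^ 2 : ℝ) : ℂ) * A n + ((lam n * Real.sqrt (1 - lam n ^ 2) : ℝ) : ℂ) * B n
      = ((lam n ^ 2 : ℝ) : ℂ) * C n + ((lam n / Real.sqrt (1 - lam n ^ 2) : ℝ) : ℂ) * B n := by
    intro n
    rw [h4 n, hsym n, add_zero]
    have hf := congrArg (fun r : ℝ => (r : ℂ)) (thm_4_7_footnote (hlam n))
    simp only [Complex.ofReal_add, Complex.ofReal_mul, Complex.ofReal_pow, Complex.ofReal_div] at hf ⊢
    linear_combination (B n) * hf
  simp_rw [key] at h1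
  have hB : HasSum (fun n => ((lam n / Real.sqrt (1 - lam n ^ 2) : ℝ) : ℂ) * B n)
      (δρ - ∑' n, ((lam n ^ 2 : ℝ) : ℂ) * C n) := by
    have h := h1.sub hC.hasSum
    simp_rw [add_sub_cancel_left] at h
    exact h
  refine ⟨hB, ?_⟩
  rw [hB.tsum_eq, sub_sub_cancel]
  exact hC.hasSum

/-! ## The symmetric extension of (chirem3) -/

/-- RH-FREE. **Symmetric extension** (Thm. 4.7 proof, p0018:L75–77).  Suppose (chirem3) holds for
`ρ = e^{−t} ≥ 1`, i.e. for every `t ≤ 0`: `δ(e^{t}) = Σ_n μ_n ⟨χ_n|ϑ(e^{t})χ_n⟩ + ε(e^{|t|})` (we use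
`δ(ρ⁻¹) = δ(ρ)` to write the left side at `e^{t}`), with real-valued vectors `χ_n`.  Then the same
identity holds for every `t ∈ ℝ`: `δ` is symmetric (`traceRemainder_inv`, Prop. 2.2 (ii)), `ε` is
symmetric (`epsDensity_neg`), and so is each diagonal coefficient (`scalingCoeff_self_neg_of_conj`).
[cite: ConnesConsani2021, Thm. 4.7 proof §4 p. 18 (arXiv chunk p0018:L75–77)] -/
theorem hasSum_chirem3_of_nonpos {ι : Type*} {μ : ι → ℝ} {χ : ι → Lp ℂ 2 (volume : Measure ℝ)}
    (hχ : ∀ n, ∀ᵐ v : ℝ, conj ((χ n : ℝ → ℂ) v) = (χ n : ℝ → ℂ) v) {ψ : ℕ → ℝ → ℝ}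
    (h : ∀ t : ℝ, t ≤ 0 → HasSum (fun n => (μ n : ℂ) * scalingCoeff (χ n) (χ n) t)
      ((traceRemainder (Real.exp t) : ℂ) - epsDensity ψ t)) (t : ℝ) :
    HasSum (fun n => (μ n : ℂ) * scalingCoeff (χ n) (χ n) t)
      ((traceRemainder (Real.exp t) : ℂ) - epsDensity ψ t) := by
  rcases le_or_gt t 0 with ht | ht
  · exact h t ht
  · have h' := h (-t) (by linarith)
    simp_rw [scalingCoeff_self_neg_of_conj _ (hχ _)] at h'
    rwa [Real.exp_neg, traceRemainder_inv, epsDensity_neg] at h'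

/-! ## Termwise integration against an `L¹` weight -/

/-- RH-FREE. **Termwise integration** (dominated convergence for series): if `c_n : ℝ → ℂ` are
continuous with `‖c_n(t)‖ ≤ M_n`, `Σ M_n < ∞`, and `Σ_n c_n(t) = S(t)` for every `t`, then for every
`k ∈ L¹(ℝ)`, `Σ_n ∫ k c_n = ∫ k S`.  (The analytic content of "we thus obtain, for any test function `f`,
`∫ f(ρ⁻¹)δ(ρ)d*ρ = ∫ f(ρ⁻¹)ε(ρ)d*ρ + Σ λ(n)²⟨ζ_n|ϑ(f)ζ_n⟩`", p0018:L75–77, where the domination is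
`Σ λ(n)² ‖ζ_n‖² = Σ λ(n)² < ∞`, Rem. 4.6 (i).) [cite: ConnesConsani2021, Thm. 4.7 proof §4 p. 18 (arXiv chunk p0018:L75–77)] -/
theorem hasSum_integral_mul_of_summable_bound {ι : Type*} [Countable ι] {k : ℝ → ℂ}
    (hk : Integrable k) {c : ι → ℝ → ℂ} (hc : ∀ n, Continuous (c n)) {M : ι → ℝ}
    (hM : ∀ n t, ‖c n t‖ ≤ M n) (hMs : Summable M) {S : ℝ → ℂ}
    (hS : ∀ t, HasSum (fun n => c n t) (S t)) :
    HasSum (fun n => ∫ t, k t * c n t) (∫ t, k t * S t) := by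
  refine hasSum_integral_of_dominated_convergence (fun n t => ‖k t‖ * M n)
    (fun n => hk.aestronglyMeasurable.mul (hc n).aestronglyMeasurable) (fun n => ?_) ?_ ?_ ?_
  · exact Eventually.of_forall fun t => by
      rw [norm_mul]
      exact mul_le_mul_of_nonneg_left (hM n t) (norm_nonneg _)
  · exact Eventually.of_forall fun t => hMs.mul_left _
  · simp_rw [tsum_mul_left]
    exact hk.norm.mul_const _
  · exact Eventually.of_forall fun t => (hS t).mul_left _

/-- RH-FREE. **The series of diagonal coefficients**: with `Σ |μ_n| ‖χ_n‖² < ∞`, the function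
`t ↦ Σ_n μ_n ⟨χ_n|ϑ(e^t)χ_n⟩` is a uniformly convergent series of continuous functions, hence
continuous (Weierstrass). [cite: ConnesConsani2021, Rem. 4.6 (i) §4 p. 18 (arXiv chunk p0018:L2); App. F Lemma F.1 = arXiv Lemma 49] -/
theorem continuous_tsum_scalingCoeff {ι : Type*} {μ : ι → ℝ} {χ : ι → Lp ℂ 2 (volume : Measure ℝ)}
    (hs : Summable fun n => |μ n| * ‖χ n‖ ^ 2) :
    Continuous fun t : ℝ => ∑' n, (μ n : ℂ) * scalingCoeff (χ n) (χ n) t := by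
  refine continuous_tsum (fun n => continuous_const.mul (continuous_scalingCoeff _ _)) hs
    fun n t => ?_
  rw [norm_mul, Complex.norm_real, Real.norm_eq_abs, sq]
  exact mul_le_mul_of_nonneg_left (norm_scalingCoeff_le _ _ _) (abs_nonneg _)

/-! ## The integrated identity: `D(f) − E(f) = Σ λ(n)²⟨ζ_n|ϑ(f)ζ_n⟩` -/

/-- RH-FREE. **(chirem3) integrated against a test function** (Thm. 4.7 proof, p0018:L75–77:
"`∫ f(ρ⁻¹)δ(ρ)d*ρ = ∫ f(ρ⁻¹)ε(ρ)d*ρ + Σ λ(n)²⟨ζ_n|ϑ(f)ζ_n⟩`").  In the tree's typing: if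
`Σ |μ_n|‖χ_n‖² < ∞` and for every `t` `δ(e^t) − ε(e^{|t|}) = Σ_n μ_n⟨χ_n|ϑ(e^t)χ_n⟩` (the symmetrically
extended (chirem3), `hasSum_chirem3_of_nonpos`), then for every test function `k` (additive avatar of
`f`): `HasSum (n ↦ μ_n · soninTraceForm k χ_n) (remainderD k − evenFunctional (epsDensity ψ) k)`, i.e.
`Σ_n μ_n⟨χ_n|ϑ(f)χ_n⟩ = D(f) − E(f)`.  Both `D(f)` and `E(f)` are honest integrals here: `δ ∘ exp` is
integrable (`integrable_traceRemainder_exp`, seat t1) and `ε ∘ exp = δ ∘ exp − Σ` with `Σ` a bounded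
continuous function (`continuous_tsum_scalingCoeff`).
[cite: ConnesConsani2021, Thm. 4.7 proof §4 p. 18 (arXiv chunk p0018:L75–77)] -/
theorem hasSum_soninTraceForm_of_chirem3 {ψ : ℕ → ℝ → ℝ} {ι : Type*} [Countable ι] {μ : ι → ℝ}
    {χ : ι → Lp ℂ 2 (volume : Measure ℝ)} (hs : Summable fun n => |μ n| * ‖χ n‖ ^ 2)
    (h3 : ∀ t : ℝ, HasSum (fun n => (μ n : ℂ) * scalingCoeff (χ n) (χ n) t)
      ((traceRemainder (Real.exp t) : ℂ) - epsDensity ψ t))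
    {k : ℝ → ℂ} (hk : IsWeilTest k) :
    HasSum (fun n => (μ n : ℂ) * soninTraceForm k (χ n))
      (remainderD k - evenFunctional (epsDensity ψ) k) := by
  have hkc : Continuous k := hk.1.continuous
  have hki : Integrable k := hkc.integrable_of_hasCompactSupport hk.2
  obtain ⟨C, hC⟩ := hkc.bounded_above_of_compact_support hk.2
  -- termwise integration of the series of coefficients against `k`
  have hbd : ∀ n t, ‖(μ n : ℂ) * scalingCoeff (χ n) (χ n) t‖ ≤ |μ n| * ‖χ n‖ ^ 2 := fun n t => by
    rw [norm_mul, Complex.norm_real, Real.norm_eq_abs, sq]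
    exact mul_le_mul_of_nonneg_left (norm_scalingCoeff_le _ _ _) (abs_nonneg _)
  have H := hasSum_integral_mul_of_summable_bound hki
    (c := fun n t => (μ n : ℂ) * scalingCoeff (χ n) (χ n) t)
    (fun n => continuous_const.mul (continuous_scalingCoeff _ _)) hbd hs h3
  -- the left side: `∫ k(t) μ_n ⟨χ_n|ϑ(e^t)χ_n⟩ dt = μ_n · soninTraceForm k χ_n`
  have hL : (fun n => ∫ t, k t * ((μ n : ℂ) * scalingCoeff (χ n) (χ n) t)) =
      fun n => (μ n : ℂ) * soninTraceForm k (χ n) := by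
    funext n
    rw [soninTraceForm, ← integral_const_mul]
    refine integral_congr_ae (Eventually.of_forall fun t => ?_)
    ring
  -- `k · (δ ∘ exp)` is integrable (`k` bounded, `δ ∘ exp ∈ L¹`), and so is `k · Σ` (`Σ` bounded continuous)
  have hδi : Integrable fun t => k t * (traceRemainder (Real.exp t) : ℂ) :=
    (integrable_traceRemainder_exp.ofReal).bdd_mul hkc.aestronglyMeasurable
      (Eventually.of_forall hC)
  have hSc := continuous_tsum_scalingCoeff hs
  have hSi : Integrable fun t => k t * ∑' n, (μ n : ℂ) * scalingCoeff (χ n) (χ n) t :=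
    hki.mul_bdd hSc.aestronglyMeasurable (c := ∑' n, |μ n| * ‖χ n‖ ^ 2)
      (Eventually.of_forall fun t => tsum_of_norm_bounded hs.hasSum fun n => hbd n t)
  -- hence `k · (ε ∘ exp ∘ |·|)` is integrable: `ε(e^{|t|}) = δ(e^t) − Σ(t)`
  have hεeq : ∀ t : ℝ, epsDensity ψ |t| =
      (traceRemainder (Real.exp t) : ℂ) - ∑' n, (μ n : ℂ) * scalingCoeff (χ n) (χ n) t := fun t => by
    rw [epsDensity_abs, (h3 t).tsum_eq]
    ring
  have hεi : Integrable fun t => k t * epsDensity ψ |t| := by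
    have := hδi.sub hSi
    refine this.congr (Eventually.of_forall fun t => ?_)
    simp only [Pi.sub_apply, hεeq]
    ring
  have hR : (∫ t, k t * ((traceRemainder (Real.exp t) : ℂ) - epsDensity ψ t)) =
      remainderD k - evenFunctional (epsDensity ψ) k := by
    rw [remainderD, evenFunctional, ← integral_sub hδi hεi]
    refine integral_congr_ae (Eventually.of_forall fun t => ?_)
    simp only [epsDensity_abs]
    ring
  rw [hL, hR] at H
  exact H

/-- RH-FREE. **Hypothesis (hA) of the O4a bridge, from (chirem3)**: for `f = g ∗ g*` (`g` a test
function), `HasSum (n ↦ μ_n · Re⟨χ_n|ϑ(f)χ_n⟩) (Re D(f) − Re E(f))` — literally the input `hA` of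
`ScalingOperator.sum_re_soninTraceForm_le_of_decomposition` with `A = Re remainderD f −
Re evenFunctional (epsDensity ψ) f` (`μ_n = λ(n)²`, `χ_n = ζ_n`).  Real parts of
`hasSum_soninTraceForm_of_chirem3`. [cite: ConnesConsani2021, Thm. 4.7 proof §4 p. 18 (arXiv chunk p0018:L75–81)] -/
theorem hasSum_re_soninTraceForm_of_chirem3 {ψ : ℕ → ℝ → ℝ} {ι : Type*} [Countable ι] {μ : ι → ℝ}
    {χ : ι → Lp ℂ 2 (volume : Measure ℝ)} (hs : Summable fun n => |μ n| * ‖χ n‖ ^ 2)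
    (h3 : ∀ t : ℝ, HasSum (fun n => (μ n : ℂ) * scalingCoeff (χ n) (χ n) t)
      ((traceRemainder (Real.exp t) : ℂ) - epsDensity ψ t))
    {g : ℝ → ℂ} (hg : IsWeilTest g) :
    HasSum (fun n => μ n * (soninTraceForm (weilConv g (weilReflect g)) (χ n)).re)
      ((remainderD (weilConv g (weilReflect g))).re
        - (evenFunctional (epsDensity ψ) (weilConv g (weilReflect g))).re) := by
  have H := Complex.hasSum_re
    (hasSum_soninTraceForm_of_chirem3 hs h3 (hg.weilConv hg.weilReflect))
  rw [Complex.sub_re] at H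
  refine H.congr_fun fun n => ?_
  rw [Complex.re_ofReal_mul]

/-! ## From Prop. 4.5 / Rem. 4.6 (seat t3's statements, `ProlateProjections.lean`) to (chirem3) and (hA)
for THE prolate family `prolateFun` -/

section ProlateFamily

/-- RH-FREE. The two seats' `λ(n)` agree: `prolateLambda (prolateFun n) = prolateEigen n` (same formula).
[cite: ConnesConsani2021, §4 eq. (prolateeq) p. 16 (arXiv chunk p0016:L19–23)] -/
theorem prolateLambda_prolateFun (n : ℕ) : prolateLambda (prolateFun n) = prolateEigen n := rfl

/-- RH-FREE. The two seats' `ψ_n = P𝔽_{e_ℝ}ξ_n` agree: `prolateCutFourier (prolateFun n) = prolatePsiFun n`.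
[cite: ConnesConsani2021, Prop. 4.5 (i) §4 p. 16 (arXiv chunk p0016:L50)] -/
theorem prolateCutFourier_prolateFun (n : ℕ) : prolateCutFourier (prolateFun n) = prolatePsiFun n := rfl

/-- RH-FREE. `repCoeff u v e^{−t} = scalingCoeff u v t` (`⟨u|ϑ(ρ⁻¹)v⟩` at `ρ = e^{−t}` is `⟨u|ϑ(e^{t})v⟩`).
[cite: ConnesConsani2021, §4 eq. (40) p. 15] -/
theorem repCoeff_exp_neg (u v : ℝ → ℂ) (t : ℝ) :
    repCoeff u v (Real.exp (-t)) = scalingCoeff u v t := by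
  rw [repCoeff, Real.log_exp, neg_neg]

/-- RH-FREE. `ψ_n = (1 − λ(n)²)^{1/2} ζ_n` pointwise (definition of `ζ_n`, Prop. 4.5 (iii), for `|λ(n)| < 1`).
[cite: ConnesConsani2021, Prop. 4.5 (iii) §4 p. 16 (arXiv chunk p0016:L56–59)] -/
theorem prolatePsiFun_eq_sqrt_mul_zetaFun {n : ℕ} (hl : |prolateEigen n| < 1) :
    prolatePsiFun n = fun v => ((Real.sqrt (1 - prolateEigen n ^ 2) : ℝ) : ℂ) * prolateZetaFun n v := by
  have h1 : 0 < 1 - prolateEigen n ^ 2 := by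
    have := abs_lt.1 hl
    nlinarith
  have hs : Real.sqrt (1 - prolateEigen n ^ 2) ≠ 0 := (Real.sqrt_pos.2 h1).ne'
  funext v
  simp only [prolateZetaFun]
  rw [← mul_assoc, ← Complex.ofReal_mul, mul_inv_cancel₀ hs, Complex.ofReal_one, one_mul]

/-- RH-FREE. `‖ζ_n‖ = 1` from `‖ψ_n‖ = (1 − λ(n)²)^{1/2}` (Prop. 4.5 (iii)) and `|λ(n)| < 1`.
[cite: ConnesConsani2021, Prop. 4.5 (iii) §4 p. 16 (arXiv chunk p0016:L56–59)] -/
theorem norm_prolateZeta_of (hiii : CC2021_prop_4_5_iii) {n : ℕ} (hl : |prolateEigen n| < 1) :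
    ‖prolateZeta n‖ = 1 := by
  have h1 : 0 < 1 - prolateEigen n ^ 2 := by
    have := abs_lt.1 hl
    nlinarith
  have hs : 0 < Real.sqrt (1 - prolateEigen n ^ 2) := Real.sqrt_pos.2 h1
  rw [prolateZeta, norm_smul, hiii.2.2.1 n, Complex.norm_real, Real.norm_eq_abs, abs_inv,
    abs_of_pos hs, inv_mul_cancel₀ hs.ne']

/-- RH-FREE. `ζ_n` is real valued (a.e., as an `L²` class): `ψ_n` is real valued (Prop. 4.5 (iii)) and
`ζ_n = (1 − λ(n)²)^{-1/2}ψ_n`. [cite: ConnesConsani2021, Prop. 4.5 (iii) §4 p. 16 (arXiv chunk p0016:L56)] -/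
theorem prolateZeta_conj_ae (hiii : CC2021_prop_4_5_iii) (n : ℕ) :
    ∀ᵐ v : ℝ, conj ((prolateZeta n : ℝ → ℂ) v) = (prolateZeta n : ℝ → ℂ) v := by
  filter_upwards [prolateZeta_coeFn n] with v hv
  rw [hv]
  simp only [prolateZetaFun, map_mul, Complex.conj_ofReal, hiii.1 n v]

/-- RH-FREE. The `n`-th term of (sonine0) at THE prolate family is `τ(n)⟨ξ_n|ϑ(ρ⁻¹)ζ_n⟩` in seat t3's
vocabulary: `epsTerm (prolateFun n) (−t) = τ(n) · scalingCoeff ξ_n ζ_n t` (for `|λ(n)| < 1`).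
[cite: ConnesConsani2021, Thm. 4.7 eq. (sonine0) §4 p. 18 (arXiv chunk p0018:L37–40)] -/
theorem epsTerm_prolateFun {n : ℕ} (hl : |prolateEigen n| < 1) (t : ℝ) :
    epsTerm (prolateFun n) (-t) =
      ((prolateEigen n / Real.sqrt (1 - prolateEigen n ^ 2) : ℝ) : ℂ) *
        scalingCoeff (prolateXiFun n) (prolateZetaFun n) t := by
  have h1 : 0 < 1 - prolateEigen n ^ 2 := by
    have := abs_lt.1 hl
    nlinarith
  have hs : 0 < Real.sqrt (1 - prolateEigen n ^ 2) := Real.sqrt_pos.2 h1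
  have hss : Real.sqrt (1 - prolateEigen n ^ 2) ^ 2 = 1 - prolateEigen n ^ 2 := Real.sq_sqrt h1.le
  have key : prolateEigen n / (1 - prolateEigen n ^ 2) * Real.sqrt (1 - prolateEigen n ^ 2) =
      prolateEigen n / Real.sqrt (1 - prolateEigen n ^ 2) := by
    rw [div_mul_eq_mul_div, div_eq_div_iff h1.ne' hs.ne', mul_assoc, ← pow_two, hss]
  rw [epsTerm, neg_neg, prolateLambda_prolateFun, prolateCutFourier_prolateFun,
    prolatePsiFun_eq_sqrt_mul_zetaFun hl, scalingCoeff_const_mul_right, ← mul_assoc,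
    ← Complex.ofReal_mul, key]
  rfl

/-- RH-FREE. **(chirem3) for THE prolate family — core form with the MINIMAL printed inputs as
hypotheses**: Prop. 4.5 (ii) (chirem1), (iv) (hattrick), Rem. 4.6 (i) (`Σλ(n)² = δ(1)`), the second half
of (sym1) (`⟨ζ_n|ϑ(ρ⁻¹)ξ_n⟩ = 0`, `ρ ≥ 1`), `ζ_n` real valued (a.e.), `‖ζ_n‖ = 1` and `|λ(n)| < 1`:
`Σ_n λ(n)² ⟨ζ_n|ϑ(e^t)ζ_n⟩ = δ(e^t) − ε(e^{|t|})`.  Steps as printed (p0018:L45–77): substitute (hattrick)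
into (chirem1), kill `⟨ζ_n|ϑ(ρ⁻¹)ξ_n⟩` by (sym1), use the footnote identity, split off `ε` (its series
converges because `Σλ(n)²⟨ζ_n|ϑ(ρ⁻¹)ζ_n⟩` does: `|⟨ζ_n|ϑζ_n⟩| ≤ ‖ζ_n‖² = 1`), then extend from `ρ ≥ 1`
to all `ρ` by the symmetry of `δ`, `ε` and of the diagonal coefficients of the real vectors `ζ_n`.
[cite: ConnesConsani2021, Thm. 4.7 proof §4 p. 18 (arXiv chunk p0018:L45–77)] -/
theorem hasSum_chirem3_prolate_of (hii : CC2021_prop_4_5_ii) (hiv : CC2021_prop_4_5_iv)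
    (h46i : CC2021_rem_4_6_i)
    (hsym1 : ∀ n : ℕ, ∀ ρ : ℝ, 1 ≤ ρ → repCoeff (prolateZetaFun n) (prolateXiFun n) ρ = 0)
    (hreal : ∀ n : ℕ, ∀ᵐ v : ℝ, conj ((prolateZeta n : ℝ → ℂ) v) = (prolateZeta n : ℝ → ℂ) v)
    (hnorm : ∀ n : ℕ, ‖prolateZeta n‖ = 1) (hl1 : ∀ n : ℕ, |prolateEigen n| < 1) (t : ℝ) :
    HasSum (fun n : ℕ => ((prolateEigen n ^ 2 : ℝ) : ℂ) *
        scalingCoeff (prolateZeta n) (prolateZeta n) t)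
      ((traceRemainder (Real.exp t) : ℂ) - epsDensity prolateFun t) := by
  refine hasSum_chirem3_of_nonpos hreal (fun s hs0 => ?_) t
  -- `ρ = e^{−s} ≥ 1`
  have hρ1 : 1 ≤ Real.exp (-s) := Real.one_le_exp (by linarith)
  have hρ0 : 0 < Real.exp (-s) := Real.exp_pos _
  -- the coefficients at `ρ` are the tree's `scalingCoeff … s`; the diagonal ones of `ζ_n` on `L²` classes
  have hζ : ∀ n, scalingCoeff (prolateZetaFun n) (prolateZetaFun n) s =
      scalingCoeff (prolateZeta n) (prolateZeta n) s := fun n =>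
    scalingCoeff_congr_ae (prolateZeta_coeFn n).symm (prolateZeta_coeFn n).symm s
  -- (chirem1) at `ρ`, rewritten with `ψ_n = (1 − λ²)^{1/2} ζ_n`
  have h1 : HasSum (fun n => ((prolateEigen n ^ 2 : ℝ) : ℂ) *
        scalingCoeff (prolateXiFun n) (prolateXiFun n) s
      + ((prolateEigen n * Real.sqrt (1 - prolateEigen n ^ 2) : ℝ) : ℂ) *
        scalingCoeff (prolateXiFun n) (prolateZetaFun n) s) (traceRemainder (Real.exp (-s)) : ℂ) := by
    refine (hii _ hρ1).congr_fun fun n => ?_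
    rw [repCoeff_exp_neg, repCoeff_exp_neg, prolatePsiFun_eq_sqrt_mul_zetaFun (hl1 n),
      scalingCoeff_const_mul_right]
    push_cast
    ring
  -- (hattrick) and (sym1) at `ρ`
  have h4 : ∀ n, scalingCoeff (prolateXiFun n) (prolateXiFun n) s =
      scalingCoeff (prolateZetaFun n) (prolateZetaFun n) s +
        ((prolateEigen n / Real.sqrt (1 - prolateEigen n ^ 2) : ℝ) : ℂ) *
          (scalingCoeff (prolateXiFun n) (prolateZetaFun n) s +
            scalingCoeff (prolateZetaFun n) (prolateXiFun n) s) := fun n => by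
    have := hiv n _ hρ0
    simp only [repCoeff_exp_neg] at this
    exact this
  have hsym : ∀ n, scalingCoeff (prolateZetaFun n) (prolateXiFun n) s = 0 := fun n => by
    have := hsym1 n _ hρ1
    rwa [repCoeff_exp_neg] at this
  -- `Σ λ(n)² ⟨ζ_n|ϑζ_n⟩` converges: `|⟨ζ_n|ϑζ_n⟩| ≤ ‖ζ_n‖² = 1`, `Σ λ(n)² < ∞`
  have hC : Summable fun n => ((prolateEigen n ^ 2 : ℝ) : ℂ) *
      scalingCoeff (prolateZetaFun n) (prolateZetaFun n) s := by
    refine Summable.of_norm_bounded (g := fun n => prolateEigen n ^ 2) h46i.summable fun n => ?_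
    rw [norm_mul, Complex.norm_real, Real.norm_eq_abs, abs_of_nonneg (sq_nonneg _), hζ n]
    refine mul_le_of_le_one_right (sq_nonneg _) ?_
    exact (norm_scalingCoeff_le _ _ _).trans (le_of_eq (by rw [hnorm n, mul_one]))
  have h3 : HasSum (fun n => ((prolateEigen n ^ 2 : ℝ) : ℂ) *
        scalingCoeff (prolateZetaFun n) (prolateZetaFun n) s)
      ((traceRemainder (Real.exp (-s)) : ℂ) -
        ∑' n, ((prolateEigen n / Real.sqrt (1 - prolateEigen n ^ 2) : ℝ) : ℂ) *
          scalingCoeff (prolateXiFun n) (prolateZetaFun n) s) :=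
    (hasSum_chirem3_of_chirem1' hl1 h1 h4 hsym hC).2
  -- identify the `ε`-series with `epsDensity prolateFun s` (`s ≤ 0`, so `|s| = −s`)
  have hεeq : epsDensity prolateFun s =
      ∑' n, ((prolateEigen n / Real.sqrt (1 - prolateEigen n ^ 2) : ℝ) : ℂ) *
        scalingCoeff (prolateXiFun n) (prolateZetaFun n) s := by
    rw [epsDensity, abs_of_nonpos hs0]
    exact tsum_congr fun n => epsTerm_prolateFun (hl1 n) s
  rw [Real.exp_neg, traceRemainder_inv, ← hεeq] at h3
  simp_rw [hζ] at h3
  exact h3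

/-- RH-FREE. **(chirem3) for THE prolate family, for all `ρ` (additive variable `t`), from seat t3's six
§4 named facts** — Prop. 4.5 (ii) (chirem1), (iii) (`ψ_n` real, `‖ψ_n‖`), (iv) (hattrick), Rem. 4.6 (i)
(`Σλ(n)² < ∞`), (ii) (sym1), and `|λ(n)| < 1`: `Σ_n λ(n)² ⟨ζ_n|ϑ(e^t)ζ_n⟩ = δ(e^t) − ε(e^{|t|})`
(`hasSum_chirem3_prolate_of` fed with the facts; see `hasSum_chirem3_prolate'` for the version using
seat t3's DISCHARGED inputs). [cite: ConnesConsani2021, Thm. 4.7 proof §4 p. 18 (arXiv chunk p0018:L45–77)] -/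
theorem hasSum_chirem3_prolate (hii : CC2021_prop_4_5_ii) (hiii : CC2021_prop_4_5_iii)
    (hiv : CC2021_prop_4_5_iv) (h46i : CC2021_rem_4_6_i) (h46ii : CC2021_rem_4_6_ii)
    (hlam : CC2021_sec4_lambda_basic) (t : ℝ) :
    HasSum (fun n : ℕ => ((prolateEigen n ^ 2 : ℝ) : ℂ) *
        scalingCoeff (prolateZeta n) (prolateZeta n) t)
      ((traceRemainder (Real.exp t) : ℂ) - epsDensity prolateFun t) :=
  hasSum_chirem3_prolate_of hii hiv h46i (fun n ρ hρ => (h46ii n ρ hρ).2) (prolateZeta_conj_ae hiii)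
    (fun n => norm_prolateZeta_of hiii (hlam.2.1 n)) hlam.2.1 t

/-- RH-FREE. `‖ζ_n‖ = 1`, UNCONDITIONALLY — from seat t3's discharged `‖ψ_n‖ = (1 − λ(n)²)^{1/2}`
(`norm_prolatePsi`) and `|λ(n)| < 1` (`abs_prolateEigen_lt_one`).
[cite: ConnesConsani2021, Prop. 4.5 (iii) §4 p. 16 (arXiv chunk p0016:L56–59)] -/
theorem norm_prolateZeta_eq_one (n : ℕ) : ‖prolateZeta n‖ = 1 := by
  have hl := abs_prolateEigen_lt_one n
  have h1 : 0 < 1 - prolateEigen n ^ 2 := by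
    have := abs_lt.1 hl
    nlinarith
  have hs : 0 < Real.sqrt (1 - prolateEigen n ^ 2) := Real.sqrt_pos.2 h1
  rw [prolateZeta, norm_smul, norm_prolatePsi n, Complex.norm_real, Real.norm_eq_abs, abs_inv,
    abs_of_pos hs, inv_mul_cancel₀ hs.ne']

/-- RH-FREE. `ζ_n` is real valued (a.e.), UNCONDITIONALLY — from seat t3's discharged `conj ψ_n = ψ_n`
(`conj_prolatePsiFun`). [cite: ConnesConsani2021, Prop. 4.5 (iii) §4 p. 16 (arXiv chunk p0016:L56)] -/
theorem prolateZeta_conj_ae' (n : ℕ) :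
    ∀ᵐ v : ℝ, conj ((prolateZeta n : ℝ → ℂ) v) = (prolateZeta n : ℝ → ℂ) v := by
  filter_upwards [prolateZeta_coeFn n] with v hv
  rw [hv]
  simp only [prolateZetaFun, map_mul, Complex.conj_ofReal, conj_prolatePsiFun n v]

/-- RH-FREE. **(chirem3) for THE prolate family from THREE named facts only** — Prop. 4.5 (ii) (chirem1),
Prop. 4.5 (iv) (hattrick) and Rem. 4.6 (i) (`Σλ(n)² = δ(1)`); the other printed inputs ((sym1),
`ψ_n` real, `‖ψ_n‖ = (1 − λ(n)²)^{1/2}`, `|λ(n)| < 1`) are seat t3's DISCHARGED theorems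
(`CC2021_rem_4_6_ii_holds`, `conj_prolatePsiFun`, `norm_prolatePsi`, `abs_prolateEigen_lt_one`).
[cite: ConnesConsani2021, Thm. 4.7 proof §4 p. 18 (arXiv chunk p0018:L45–77)] -/
theorem hasSum_chirem3_prolate' (hii : CC2021_prop_4_5_ii) (hiv : CC2021_prop_4_5_iv)
    (h46i : CC2021_rem_4_6_i) (t : ℝ) :
    HasSum (fun n : ℕ => ((prolateEigen n ^ 2 : ℝ) : ℂ) *
        scalingCoeff (prolateZeta n) (prolateZeta n) t)
      ((traceRemainder (Real.exp t) : ℂ) - epsDensity prolateFun t) :=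
  hasSum_chirem3_prolate_of hii hiv h46i (fun n ρ hρ => (CC2021_rem_4_6_ii_holds n ρ hρ).2)
    prolateZeta_conj_ae' norm_prolateZeta_eq_one abs_prolateEigen_lt_one t

/-- RH-FREE. **The §4 half of the discharge of Theorem 4.7's weak form — hypothesis (hA) of
`ScalingOperator.sum_re_soninTraceForm_le_of_decomposition` for THE prolate family — from the printed
inputs Prop. 4.5 (ii)–(iv), Rem. 4.6 (i)–(ii) and `|λ(n)| < 1` (seat t3's named facts) and the tree's
`integrable_traceRemainder_exp` (seat t1, proved):** for every test function `g`,
`Σ_n λ(n)² Re⟨ζ_n|ϑ(g ∗ g*)ζ_n⟩ = Re D(g ∗ g*) − Re E(g ∗ g*)` with `D = remainderD`,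
`E = evenFunctional (epsDensity prolateFun)` ("`∫ f(ρ⁻¹)δ(ρ)d*ρ = ∫ f(ρ⁻¹)ε(ρ)d*ρ + Σ λ(n)²⟨ζ_n|ϑ(f)ζ_n⟩`",
Thm. 4.7 proof p0018:L75–77).  No trace class, no RH.
[cite: ConnesConsani2021, Thm. 4.7 proof §4 p. 18 (arXiv chunk p0018:L45–81)] -/
theorem hasSum_re_soninTraceForm_prolate (hii : CC2021_prop_4_5_ii) (hiii : CC2021_prop_4_5_iii)
    (hiv : CC2021_prop_4_5_iv) (h46i : CC2021_rem_4_6_i) (h46ii : CC2021_rem_4_6_ii)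
    (hlam : CC2021_sec4_lambda_basic) {g : ℝ → ℂ} (hg : IsWeilTest g) :
    HasSum (fun n : ℕ => prolateEigen n ^ 2 *
        (soninTraceForm (weilConv g (weilReflect g)) (prolateZeta n)).re)
      ((remainderD (weilConv g (weilReflect g))).re
        - (evenFunctional (epsDensity prolateFun) (weilConv g (weilReflect g))).re) := by
  have hs : Summable fun n : ℕ => |prolateEigen n ^ 2| * ‖prolateZeta n‖ ^ 2 := by
    refine h46i.summable.congr fun n => ?_
    rw [norm_prolateZeta_of hiii (hlam.2.1 n), abs_of_nonneg (sq_nonneg _)]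
    ring
  exact hasSum_re_soninTraceForm_of_chirem3 hs (hasSum_chirem3_prolate hii hiii hiv h46i h46ii hlam) hg

/-- RH-FREE. **(hA) from THREE named facts only** (Prop. 4.5 (ii), (iv), Rem. 4.6 (i); the rest of the
printed inputs are seat t3's discharged theorems): for every test function `g`,
`Σ_n λ(n)² Re⟨ζ_n|ϑ(g ∗ g*)ζ_n⟩ = Re D(g ∗ g*) − Re E(g ∗ g*)`.
[cite: ConnesConsani2021, Thm. 4.7 proof §4 p. 18 (arXiv chunk p0018:L45–81)] -/
theorem hasSum_re_soninTraceForm_prolate' (hii : CC2021_prop_4_5_ii) (hiv : CC2021_prop_4_5_iv)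
    (h46i : CC2021_rem_4_6_i) {g : ℝ → ℂ} (hg : IsWeilTest g) :
    HasSum (fun n : ℕ => prolateEigen n ^ 2 *
        (soninTraceForm (weilConv g (weilReflect g)) (prolateZeta n)).re)
      ((remainderD (weilConv g (weilReflect g))).re
        - (evenFunctional (epsDensity prolateFun) (weilConv g (weilReflect g))).re) := by
  have hs : Summable fun n : ℕ => |prolateEigen n ^ 2| * ‖prolateZeta n‖ ^ 2 := by
    refine h46i.summable.congr fun n => ?_
    rw [norm_prolateZeta_eq_one n, abs_of_nonneg (sq_nonneg _)]
    ring
  exact hasSum_re_soninTraceForm_of_chirem3 hs (hasSum_chirem3_prolate' hii hiv h46i) hg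

end ProlateFamily

/-! ## Assembly: Theorem 4.7's weak form (route item K1) from the two printed trace computations -/

section Assembly

/-- RH-FREE. **Theorem 4.7, weak form (`CC2021_thm_4_7_weak` = route item K1 `SoninTraceFormula`), ASSEMBLED
from the printed inputs of its proof**, via the O4a bridge
`ScalingOperator.sum_re_soninTraceForm_le_of_decomposition` (Hilbert–Schmidt bookkeeping, no trace
class): the §4 half (hA) is `hasSum_re_soninTraceForm_prolate` (this file, from seat t3's six facts);
what remains is taken here as hypotheses IN THE BRIDGE'S EXACT SHAPES, for bounded operators `Q`, `C`
on `L²(ℝ)` (in print `Q = P P̂ P`, `C = P̂ P`, compressed to `L²(ℝ)_ev` — see the note below):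
(hC) `Re⟨x|Qx⟩ = ‖Cx‖²`; (hQ) eq. (spectral) of Prop. 4.5 (iii) read as quadratic forms,
`Re⟨x|Qx⟩ = Σ λ(n)²|⟨ζ_n|x⟩|² + ‖𝐒x‖²` (from `CC2021_prop_4_5_spectral` on `evenPart` by compressing
with the even projection `E`: `Q := E P P̂ P E`, `C := P̂ P E`, since `ζ_n ∈ L²(ℝ)_ev`, `𝐒 = 𝐒E`);
(hL) Prop. 2.2 (iii) "`Tr(ϑ(f)PP̂P) = W_∞(f) + ∫f(ρ⁻¹)δ(ρ)d*ρ = L(f)`" in Hilbert–Schmidt form: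
`Σ_k ‖C ϑ(g) e_k‖² = Re W_∞(g ∗ g*) + Re D(g ∗ g*)` over some Hilbert basis of `L²(ℝ)` (seat t1's
`CC2021_prop_2_2_iii`, `traceL = archW + remainderD`).  Conclusion: for every archimedean density `G`,
every test `g` and every finite orthonormal family `(ξ_i)` of `S(1,1)`,
`Σ_i Re⟨ξ_i|ϑ(g ∗ g*)ξ_i⟩ ≤ Re W_∞(g ∗ g*) + Re E(g ∗ g*)` — i.e. `CC2021_thm_4_7_weak`; the identity
`L − A = (Re W_∞ + Re D) − (Re D − Re E) = Re W_∞ + Re E` is the printed "This gives the required formula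
(sonine0) provided we prove (sonine2)" (p0018:L79–87).
[cite: ConnesConsani2021, Thm. 4.7 proof §4 p. 18 (arXiv chunk p0018:L42–87)] -/
theorem CC2021_thm_4_7_weak_of_traces (hii : CC2021_prop_4_5_ii) (hiii : CC2021_prop_4_5_iii)
    (hiv : CC2021_prop_4_5_iv) (h46i : CC2021_rem_4_6_i) (h46ii : CC2021_rem_4_6_ii)
    (hlam : CC2021_sec4_lambda_basic)
    {G₀ : Type*} [NormedAddCommGroup G₀] [InnerProductSpace ℂ G₀]
    {Q : Lp ℂ 2 (volume : Measure ℝ) →L[ℂ] Lp ℂ 2 (volume : Measure ℝ)}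
    {C : Lp ℂ 2 (volume : Measure ℝ) →L[ℂ] G₀}
    (hC : ∀ x, (⟪x, Q x⟫_ℂ).re = ‖C x‖ ^ 2)
    (hQ : ∀ x, HasSum (fun n : ℕ => prolateEigen n ^ 2 * ‖⟪prolateZeta n, x⟫_ℂ‖ ^ 2)
      ((⟪x, Q x⟫_ℂ).re - ‖soninProjection 1 1 x‖ ^ 2))
    (hL : ∀ g : ℝ → ℂ, IsWeilTest g →
      ∃ (κ : Type) (e : HilbertBasis κ ℂ (Lp ℂ 2 (volume : Measure ℝ))),
        HasSum (fun k => ‖C (scalingOp g (e k))‖ ^ 2)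
          ((archW (weilConv g (weilReflect g))).re + (remainderD (weilConv g (weilReflect g))).re)) :
    CC2021_thm_4_7_weak := by
  intro G hG g hg n ξ hξ hS
  have hgi : Integrable g := hg.1.continuous.integrable_of_hasCompactSupport hg.2
  obtain ⟨κ, e, hLg⟩ := hL g hg
  have hA := hasSum_re_soninTraceForm_prolate hii hiii hiv h46i h46ii hlam hg
  have hle := sum_re_soninTraceForm_le_of_decomposition hgi (fun n => sq_nonneg (prolateEigen n))
    hC hQ e hLg hA ξ hξ hS
  rw [hG.evenFunctional_eq isProlateFunction_prolateFun]
  linarith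

/-- RH-FREE. **The same assembly with the §4 inputs cut to THREE named facts** (Prop. 4.5 (ii), (iv),
Rem. 4.6 (i)) — (sym1), `ψ_n` real, `‖ψ_n‖`, `|λ(n)| < 1` being seat t3's discharged theorems — plus the
three operator inputs (hC), (hQ), (hL) in the shapes of `sum_re_soninTraceForm_le_of_decomposition`.
[cite: ConnesConsani2021, Thm. 4.7 proof §4 p. 18 (arXiv chunk p0018:L42–87)] -/
theorem CC2021_thm_4_7_weak_of_traces' (hii : CC2021_prop_4_5_ii) (hiv : CC2021_prop_4_5_iv)
    (h46i : CC2021_rem_4_6_i)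
    {G₀ : Type*} [NormedAddCommGroup G₀] [InnerProductSpace ℂ G₀]
    {Q : Lp ℂ 2 (volume : Measure ℝ) →L[ℂ] Lp ℂ 2 (volume : Measure ℝ)}
    {C : Lp ℂ 2 (volume : Measure ℝ) →L[ℂ] G₀}
    (hC : ∀ x, (⟪x, Q x⟫_ℂ).re = ‖C x‖ ^ 2)
    (hQ : ∀ x, HasSum (fun n : ℕ => prolateEigen n ^ 2 * ‖⟪prolateZeta n, x⟫_ℂ‖ ^ 2)
      ((⟪x, Q x⟫_ℂ).re - ‖soninProjection 1 1 x‖ ^ 2))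
    (hL : ∀ g : ℝ → ℂ, IsWeilTest g →
      ∃ (κ : Type) (e : HilbertBasis κ ℂ (Lp ℂ 2 (volume : Measure ℝ))),
        HasSum (fun k => ‖C (scalingOp g (e k))‖ ^ 2)
          ((archW (weilConv g (weilReflect g))).re + (remainderD (weilConv g (weilReflect g))).re)) :
    CC2021_thm_4_7_weak := by
  intro G hG g hg n ξ hξ hS
  have hgi : Integrable g := hg.1.continuous.integrable_of_hasCompactSupport hg.2
  obtain ⟨κ, e, hLg⟩ := hL g hg
  have hA := hasSum_re_soninTraceForm_prolate' hii hiv h46i hg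
  have hle := sum_re_soninTraceForm_le_of_decomposition hgi (fun n => sq_nonneg (prolateEigen n))
    hC hQ e hLg hA ξ hξ hS
  rw [hG.evenFunctional_eq isProlateFunction_prolateFun]
  linarith

/-- RH-FREE. **THEOREM 4.7, WEAK FORM (`CC2021_thm_4_7_weak` = route item K1 `SoninTraceFormula`), FROM
FIVE NAMED FACTS OF ITS PRINTED PROOF AND NOTHING ELSE** — Prop. 2.2 (iii) (`CC2021_prop_2_2_iii`, seat
t1: `Tr(ϑ(f)PP̂P) = L(f)`), eq. (spectral) of Prop. 4.5 (iii) (`CC2021_prop_4_5_spectral`, seat t3: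
`PP̂P = Σλ(n)²|ζ_n⟩⟨ζ_n| + 𝐒` on `L²(ℝ)_ev`), Prop. 4.5 (ii) (chirem1), Prop. 4.5 (iv) (hattrick) and
Rem. 4.6 (i) (`Σλ(n)² = δ(1)`) (seat t3); every other printed input — (sym1), `ψ_n` real,
`‖ψ_n‖ = (1 − λ(n)²)^{1/2}`, `|λ(n)| < 1`, the evenness of the Sonin projections, the Hilbert–Schmidt
bookkeeping replacing "trace class" — is a PROVED theorem of the tree (seats t1, t3, O4a and this file).
Assembly: (hA) = `hasSum_re_soninTraceForm_prolate'`; the operator side is O4a's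
`SoninTraceReduction.soninTrace_partial_le_archW_add_of_spectral` (`P = soninProjection 1 0`,
`P̂ = soninProjection 0 1`, `L = W_∞ + D`); finally `E(f)` is the same number for every archimedean
density `G` (`IsArchDensity.evenFunctional_eq`).  The printed last lines: "`Tr(ϑ(f)𝐒) = Tr(ϑ(f)PP̂P) −
Σλ(n)²⟨ζ_n|ϑ(f)ζ_n⟩ = (W_∞ + D)(f) − (D − E)(f)`" (p0018:L77–87), with "partial sums ≤ trace".
[cite: ConnesConsani2021, Thm. 4.7 §4 p. 18 (statement (sonine0) and proof, arXiv chunk p0018:L33–87)] -/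
theorem CC2021_thm_4_7_weak_of_sec2_sec4 (h₂ : CC2021_prop_2_2_iii) (h₄ : CC2021_prop_4_5_spectral)
    (hii : CC2021_prop_4_5_ii) (hiv : CC2021_prop_4_5_iv) (h46i : CC2021_rem_4_6_i) :
    CC2021_thm_4_7_weak := by
  intro G hG g hg n ξ hξ hS
  have hA := hasSum_re_soninTraceForm_prolate' hii hiv h46i hg
  have hle := soninTrace_partial_le_archW_add_of_spectral h₂ h₄ hg hA ξ hξ hS
  rw [hG.evenFunctional_eq isProlateFunction_prolateFun]
  exact hle

/-- RH-FREE. The same, delivered directly as the (H-TF) binder `hTr` of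
`MainInequalityAssembly.weilArchPositivity_soninTrace_fine_of_spectralData` /
`…_of_thm_4_7_weak_of_opIneq` (statement file adapters), from the five named facts.
[cite: ConnesConsani2021, Thm. 4.7 §4 p. 18 (arXiv chunk p0018:L33–87)] -/
theorem weilArchPositivity_soninTrace_fine_of_sec2_sec4_of_opIneq (h₂ : CC2021_prop_2_2_iii)
    (h₄ : CC2021_prop_4_5_spectral) (hii : CC2021_prop_4_5_ii) (hiv : CC2021_prop_4_5_iv)
    (h46i : CC2021_rem_4_6_i) {G : ℝ → ℂ} (hGa : IsArchDensity G) {a₀ e' : ℝ}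
    (hG : ContDiff ℝ 2 G) (hGe : deriv G 0 = e') (he' : 0 < e')
    (hpos : ∀ ξ : Lp ℂ 2 (volume.restrict (Icc (-(Real.log 2 / 2)) (Real.log 2 / 2))),
      0 ≤ RCLike.re ⟪ξ, ξ - windowOp (-(Real.log 2 / 2)) (Real.log 2 / 2) (integrableOn_varpi hG _ _) ξ⟫_ℂ
            + a₀ * ‖⟪constVector (-(Real.log 2 / 2)) (Real.log 2 / 2), ξ⟫_ℂ‖ ^ 2)
    (hc : 8 * a₀ * e' / Real.log 2 < 17) :
    WeilArchPositivity_soninTrace_fine :=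
  weilArchPositivity_soninTrace_fine_of_thm_4_7_weak_of_opIneq
    (CC2021_thm_4_7_weak_of_sec2_sec4 h₂ h₄ hii hiv h46i) hGa hG hGe he' hpos hc

/-- RH-FREE. **THEOREM 4.7, WEAK FORM (`CC2021_thm_4_7_weak` = route item K1 `SoninTraceFormula`), FROM
THE TWO BOUNDARY FACTS OF RECORD AND NOTHING ELSE** — Prop. 2.2 (iii) (`CC2021_prop_2_2_iii`, seat t1:
`Tr(ϑ(f)PP̂P) = W_∞(f) + ∫f(ρ⁻¹)δ(ρ)d*ρ`) and the completeness of the even prolate spheroidal basis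
`(ξ_n)` of `𝒫₁L²(ℝ)_ev` (`CC2021_sec4_xi_complete`, Prop. 4.5 (i): "orthonormal basis", [Slepian]).
The other three §4 inputs of `CC2021_thm_4_7_weak_of_sec2_sec4` are THEOREMS modulo the latter:
eq. (spectral) `CC2021_prop_4_5_spectral_of_xi_complete`, (chirem1) `CC2021_prop_4_5_ii_of_xi_complete`,
`Σλ(n)² = δ(1)` `CC2021_rem_4_6_i_of_xi_complete` (row O12, `ProlateTraceIdentities.lean`), and
(hattrick) is seat t3's `CC2021_prop_4_5_iv_holds`.
[cite: ConnesConsani2021, Thm. 4.7 §4 p. 18 (statement (sonine0) and proof, arXiv chunk p0018:L33–87); Prop. 4.5 (i) p. 16] -/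
theorem CC2021_thm_4_7_weak_of_prop_2_2_iii_of_xi_complete (h₂ : CC2021_prop_2_2_iii)
    (hξ : CC2021_sec4_xi_complete) : CC2021_thm_4_7_weak :=
  CC2021_thm_4_7_weak_of_sec2_sec4 h₂ (CC2021_prop_4_5_spectral_of_xi_complete hξ)
    (CC2021_prop_4_5_ii_of_xi_complete hξ) CC2021_prop_4_5_iv_holds
    (CC2021_rem_4_6_i_of_xi_complete hξ)

/-- RH-FREE. The same, delivered directly as the (H-TF) binder `hTr` of
`MainInequalityAssembly.weilArchPositivity_soninTrace_fine_of_opIneq` (statement file adapter), from the two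
boundary facts `CC2021_prop_2_2_iii`, `CC2021_sec4_xi_complete`: eq. (4) from them, a `C²` archimedean
density with `G′(0) = e′ > 0`, the sign-free operator inequality (H-op) on `L²(I)` and `8a₀e′/log 2 < 17`.
RH-FREE; NOT RH-detecting. [cite: ConnesConsani2021, eq. (4) p. 4; Thm. 4.7 §4 p. 18; Thm. 6.11 §6.7 pp. 28–29] -/
theorem weilArchPositivity_soninTrace_fine_of_prop_2_2_iii_of_xi_complete_of_opIneq
    (h₂ : CC2021_prop_2_2_iii) (hξ : CC2021_sec4_xi_complete) {G : ℝ → ℂ} (hGa : IsArchDensity G)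
    {a₀ e' : ℝ} (hG : ContDiff ℝ 2 G) (hGe : deriv G 0 = e') (he' : 0 < e')
    (hpos : ∀ ξ : Lp ℂ 2 (volume.restrict (Icc (-(Real.log 2 / 2)) (Real.log 2 / 2))),
      0 ≤ RCLike.re ⟪ξ, ξ - windowOp (-(Real.log 2 / 2)) (Real.log 2 / 2) (integrableOn_varpi hG _ _) ξ⟫_ℂ
            + a₀ * ‖⟪constVector (-(Real.log 2 / 2)) (Real.log 2 / 2), ξ⟫_ℂ‖ ^ 2)
    (hc : 8 * a₀ * e' / Real.log 2 < 17) :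
    WeilArchPositivity_soninTrace_fine :=
  weilArchPositivity_soninTrace_fine_of_thm_4_7_weak_of_opIneq
    (CC2021_thm_4_7_weak_of_prop_2_2_iii_of_xi_complete h₂ hξ) hGa hG hGe he' hpos hc

end Assembly

/-! ### App. D Lemma D.1 (arXiv Lemma 47), first clause: the quantized differential of a Schwartz function is Hilbert–Schmidt -/

section QuantizedDifferential

open scoped SchwartzMap

/-- RH-FREE helper: a Schwartz function has `(1 + |x|)·‖f′(x)‖` bounded. [folklore] -/
private theorem exists_one_add_abs_mul_norm_deriv_le (f : 𝓢(ℝ, ℂ)) :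
    ∃ C : ℝ, 0 ≤ C ∧ ∀ x : ℝ, (1 + |x|) * ‖deriv (⇑f) x‖ ≤ C := by
  obtain ⟨C₀, hC₀, h₀⟩ := (SchwartzMap.derivCLM ℝ ℂ f).decay 0 0
  obtain ⟨C₁, hC₁, h₁⟩ := (SchwartzMap.derivCLM ℝ ℂ f).decay 1 0
  refine ⟨C₀ + C₁, by positivity, fun x => ?_⟩
  have e₀ := h₀ x
  have e₁ := h₁ x
  simp only [pow_zero, one_mul, pow_one, norm_iteratedFDeriv_zero, SchwartzMap.derivCLM_apply,
    Real.norm_eq_abs] at e₀ e₁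
  linarith

/-- RH-FREE helper (mean-value step of Rem. D.2 (48)'s direct estimate): on the strip `|s − t| < 1`,
`‖f(s) − f(t)‖ ≤ (2C/(1+|t|))·|s − t|` when `(1+|x|)‖f′(x)‖ ≤ C`. [folklore] -/
private theorem norm_sub_le_of_abs_sub_lt_one (f : 𝓢(ℝ, ℂ)) {C : ℝ}
    (hf : ∀ x : ℝ, (1 + |x|) * ‖deriv (⇑f) x‖ ≤ C) {s t : ℝ} (hst : |s - t| < 1) :
    ‖f s - f t‖ ≤ 2 * C / (1 + |t|) * |s - t| := by
  have hconv : Convex ℝ (uIcc t s) := convex_uIcc t s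
  have hbound : ∀ x ∈ uIcc t s, ‖deriv (⇑f) x‖ ≤ 2 * C / (1 + |t|) := by
    intro x hx
    have hxt : |x - t| ≤ |s - t| := abs_sub_left_of_mem_uIcc hx
    have h1 : (1 + |x|) * ‖deriv (⇑f) x‖ ≤ C := hf x
    have hx0 : 0 < 1 + |x| := by positivity
    have ht0 : 0 < 1 + |t| := by positivity
    have htx : 1 + |t| ≤ 2 * (1 + |x|) := by
      have : |t| ≤ |x| + |x - t| := by
        have := abs_sub_abs_le_abs_sub t x
        rw [abs_sub_comm] at this
        linarith
      linarith [abs_nonneg x]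
    rw [le_div_iff₀ ht0]
    calc ‖deriv (⇑f) x‖ * (1 + |t|) ≤ ‖deriv (⇑f) x‖ * (2 * (1 + |x|)) := by
          gcongr
      _ = 2 * ((1 + |x|) * ‖deriv (⇑f) x‖) := by ring
      _ ≤ 2 * C := by gcongr
  have h := hconv.norm_image_sub_le_of_norm_deriv_le (fun x _ => f.differentiableAt) hbound
    (left_mem_uIcc) (right_mem_uIcc)
  simpa [Real.norm_eq_abs] using h

/-- RH-FREE helper: the pointwise majorant of `|k_f(s,t)|²` used for square integrability
(Rem. D.2 (48)'s direct estimate, p0033:L39–41). [folklore] -/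
private theorem norm_quantizedDiffKernel_sq_le (f : 𝓢(ℝ, ℂ)) {C : ℝ} (hC : 0 ≤ C)
    (hf : ∀ x : ℝ, (1 + |x|) * ‖deriv (⇑f) x‖ ≤ C) (s t : ℝ) :
    ‖quantizedDiffKernel f s t‖ ^ 2 ≤
      (1 + (s - t) ^ 2)⁻¹ * (8 * C ^ 2 * (1 + t ^ 2)⁻¹ + 4 * (‖f s‖ ^ 2 + ‖f t‖ ^ 2)) := by
  -- `‖k‖ = ‖f s − f t‖ / (π |s − t|) ≤ D := ‖f s − f t‖ / |s − t|`
  set D : ℝ := ‖f s - f t‖ / |s - t| with hD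
  have hD0 : 0 ≤ D := by positivity
  have hw0 : 0 < (1 + (s - t) ^ 2)⁻¹ := by positivity
  have ha0 : 0 ≤ (1 + t ^ 2)⁻¹ := by positivity
  have hk : ‖quantizedDiffKernel f s t‖ ≤ D := by
    unfold quantizedDiffKernel
    rw [norm_mul, norm_div, norm_div, norm_I, ← ofReal_sub, Complex.norm_real, Complex.norm_real,
      Real.norm_eq_abs, Real.norm_eq_abs, abs_of_pos Real.pi_pos, hD]
    have hπ : 1 / Real.pi ≤ 1 := by
      rw [div_le_one Real.pi_pos]
      linarith [Real.pi_gt_three]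
    calc 1 / Real.pi * (‖f s - f t‖ / |s - t|) ≤ 1 * (‖f s - f t‖ / |s - t|) := by
          gcongr
      _ = _ := one_mul _
  have hk2 : ‖quantizedDiffKernel f s t‖ ^ 2 ≤ D ^ 2 := by
    gcongr
  refine hk2.trans ?_
  by_cases hst : |s - t| < 1
  · -- strip: mean value bound
    have hDle : D ≤ 2 * C / (1 + |t|) := by
      rw [hD]
      rcases eq_or_ne s t with h | h
      · simp [h]; positivity
      · rw [div_le_iff₀ (abs_pos.mpr (sub_ne_zero.mpr h))]
        exact norm_sub_le_of_abs_sub_lt_one f hf hst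
    have hsq : D ^ 2 ≤ (2 * C / (1 + |t|)) ^ 2 := by gcongr
    have h1t : (2 * C / (1 + |t|)) ^ 2 ≤ 4 * C ^ 2 * (1 + t ^ 2)⁻¹ := by
      rw [div_pow, mul_pow, ← div_eq_mul_inv, div_le_div_iff₀ (by positivity) (by positivity)]
      have : 1 + t ^ 2 ≤ (1 + |t|) ^ 2 := by
        have h := abs_nonneg t
        nlinarith [sq_abs t]
      nlinarith
    have hw : (1 : ℝ) ≤ 2 * (1 + (s - t) ^ 2)⁻¹ := by
      rw [← div_eq_mul_inv, le_div_iff₀ (by positivity)]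
      have : (s - t) ^ 2 < 1 := by
        have := abs_nonneg (s - t)
        nlinarith [sq_abs (s - t)]
      linarith
    calc D ^ 2 ≤ 4 * C ^ 2 * (1 + t ^ 2)⁻¹ := hsq.trans h1t
      _ ≤ 4 * C ^ 2 * (1 + t ^ 2)⁻¹ * (2 * (1 + (s - t) ^ 2)⁻¹) :=
          le_mul_of_one_le_right (by positivity) hw
      _ = (1 + (s - t) ^ 2)⁻¹ * (8 * C ^ 2 * (1 + t ^ 2)⁻¹) := by ring
      _ ≤ _ := by gcongr; nlinarith [norm_nonneg (f s), norm_nonneg (f t)]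
  · -- off the strip: triangle inequality and `1/|s−t|² ≤ 2/(1+(s−t)²)`
    rw [not_lt] at hst
    have hpos : 0 < |s - t| := lt_of_lt_of_le one_pos hst
    have hsq0 : 0 < (s - t) ^ 2 := by
      have h := pow_pos hpos 2
      rwa [sq_abs] at h
    have hDle : D ≤ (‖f s‖ + ‖f t‖) / |s - t| := by
      rw [hD]; gcongr; exact norm_sub_le _ _
    have hsq : D ^ 2 ≤ (‖f s‖ + ‖f t‖) ^ 2 / (s - t) ^ 2 := by
      calc D ^ 2 ≤ ((‖f s‖ + ‖f t‖) / |s - t|) ^ 2 := by gcongr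
        _ = (‖f s‖ + ‖f t‖) ^ 2 / (s - t) ^ 2 := by rw [div_pow, sq_abs]
    have hw : ((s - t) ^ 2)⁻¹ ≤ 2 * (1 + (s - t) ^ 2)⁻¹ := by
      rw [← div_eq_mul_inv, ← one_div, div_le_div_iff₀ hsq0 (by positivity)]
      have : 1 ≤ (s - t) ^ 2 := by nlinarith [sq_abs (s - t)]
      linarith
    have hnum : (‖f s‖ + ‖f t‖) ^ 2 ≤ 2 * (‖f s‖ ^ 2 + ‖f t‖ ^ 2) := by
      nlinarith [sq_nonneg (‖f s‖ - ‖f t‖)]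
    calc D ^ 2 ≤ (‖f s‖ + ‖f t‖) ^ 2 / (s - t) ^ 2 := hsq
      _ = (‖f s‖ + ‖f t‖) ^ 2 * ((s - t) ^ 2)⁻¹ := div_eq_mul_inv _ _
      _ ≤ 2 * (‖f s‖ ^ 2 + ‖f t‖ ^ 2) * (2 * (1 + (s - t) ^ 2)⁻¹) := by gcongr
      _ = (1 + (s - t) ^ 2)⁻¹ * (4 * (‖f s‖ ^ 2 + ‖f t‖ ^ 2)) := by ring
      _ ≤ _ := by gcongr; nlinarith

/-- RH-FREE helper: measurability of the kernel on `ℝ²`. [folklore] -/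
private theorem measurable_uncurry_quantizedDiffKernel (f : 𝓢(ℝ, ℂ)) :
    Measurable (Function.uncurry (quantizedDiffKernel f)) := by
  have hc : Continuous (⇑f) := f.continuous
  unfold quantizedDiffKernel Function.uncurry
  fun_prop

/-- RH-FREE helper: integrability on `ℝ²` of `(s,t) ↦ a(t)·(1 + (s−t)²)⁻¹` and of
`(s,t) ↦ a(s)·(1 + (s−t)²)⁻¹` for `a ∈ L¹(ℝ)` (the convolution integrand `a ⋆ (1+u²)⁻¹`). [folklore] -/
private theorem integrable_mul_inv_one_add_sub_sq {a : ℝ → ℝ} (ha : Integrable a) :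
    Integrable (fun p : ℝ × ℝ => a p.2 * (1 + (p.1 - p.2) ^ 2)⁻¹) ((volume : Measure ℝ).prod volume) ∧
      Integrable (fun p : ℝ × ℝ => a p.1 * (1 + (p.1 - p.2) ^ 2)⁻¹)
        ((volume : Measure ℝ).prod volume) := by
  have h1 : Integrable (fun p : ℝ × ℝ => a p.2 * (1 + (p.1 - p.2) ^ 2)⁻¹)
      ((volume : Measure ℝ).prod volume) := by
    have := ha.convolution_integrand (ContinuousLinearMap.mul ℝ ℝ) (μ := volume)
      integrable_inv_one_add_sq
    simpa using this
  refine ⟨h1, ?_⟩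
  have h2 := h1.swap
  refine (h2.congr ?_)
  filter_upwards with p
  simp only [Function.comp_apply, Prod.fst_swap, Prod.snd_swap]
  ring_nf

/-- RH-FREE. **First clause of App. D Lemma D.1 (= arXiv Lemma 47), PROVED** (Rem. D.2 (48)'s "instructive alternate proof",
p0033:L39–41: estimate directly the Schwartz kernel `k(x,y) = (f(x) − f(y))/(x − y)`): for a Schwartz
function `f` on `ℝ ≅ Ĉ` the kernel `k_f(s,t) = (i/π)(f(s) − f(t))/(s − t)` of the quantized
differential `[H, f]` is square integrable on `ℝ²`, i.e. `[H, f]` is (at least) Hilbert–Schmidt.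
Proof: on the strip `|s − t| < 1` the mean value theorem and the Schwartz decay of `f′` give
`|k| ≤ 2C/(π(1+|t|))`; off the strip `|k| ≤ (|f(s)| + |f(t)|)/(π|s − t|)`; both majorants are
dominated by `(1 + (s−t)²)⁻¹·(8C²(1+t²)⁻¹ + 4|f(s)|² + 4|f(t)|²) ∈ L¹(ℝ²)`.
[cite: ConnesConsani2021, App. D Lemma D.1 and Rem. D.2 p. 33 (= arXiv Lemma 47 / Rem. 48, chunk p0033:L22, L38–41)] -/
theorem memLp_quantizedDiffKernel (f : 𝓢(ℝ, ℂ)) :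
    MemLp (Function.uncurry (quantizedDiffKernel f)) 2 ((volume : Measure ℝ).prod volume) := by
  obtain ⟨C, hC, hf⟩ := exists_one_add_abs_mul_norm_deriv_le f
  have hmeas := (measurable_uncurry_quantizedDiffKernel f).aestronglyMeasurable
    (μ := (volume : Measure ℝ).prod volume)
  rw [memLp_two_iff_integrable_sq_norm hmeas]
  -- the two integrable weights on `ℝ`
  have ha₁ : Integrable (fun t : ℝ => (1 + t ^ 2)⁻¹) := integrable_inv_one_add_sq
  have ha₂ : Integrable (fun t : ℝ => ‖f t‖ ^ 2) :=
    (memLp_two_iff_integrable_sq_norm (f.continuous.aestronglyMeasurable)).1 (f.memLp 2)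
  obtain ⟨h₁, -⟩ := integrable_mul_inv_one_add_sub_sq ha₁
  obtain ⟨h₂, h₃⟩ := integrable_mul_inv_one_add_sub_sq ha₂
  have hG : Integrable (fun p : ℝ × ℝ =>
      (1 + (p.1 - p.2) ^ 2)⁻¹ * (8 * C ^ 2 * (1 + p.2 ^ 2)⁻¹ + 4 * (‖f p.1‖ ^ 2 + ‖f p.2‖ ^ 2)))
      ((volume : Measure ℝ).prod volume) := by
    have := ((h₁.const_mul (8 * C ^ 2)).add ((h₃.add h₂).const_mul 4))
    refine this.congr ?_
    filter_upwards with p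
    simp only [Pi.add_apply]
    ring
  refine hG.mono' (hmeas.norm.pow 2) ?_
  filter_upwards with p
  rw [Real.norm_eq_abs, abs_of_nonneg (by positivity)]
  exact norm_quantizedDiffKernel_sq_le f hC hf p.1 p.2

/-- RH-FREE. With its first clause proved (`memLp_quantizedDiffKernel`), the named fact
`CC2021_lemma_D47` is EQUIVALENT to its second clause alone: every bounded operator on `L²(ℝ)`
acting a.e. by the kernel `k_f` is of infinite order.
[cite: ConnesConsani2021, App. D Lemma D.1 p. 33 (= arXiv Lemma 47, chunk p0033:L22)] -/
theorem CC2021_lemma_D47_iff_isInfiniteOrder :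
    CC2021_lemma_D47 ↔
      ∀ f : SchwartzMap ℝ ℂ, ∀ A : Lp ℂ 2 (volume : Measure ℝ) →L[ℂ] Lp ℂ 2 (volume : Measure ℝ),
        (∀ φ : Lp ℂ 2 (volume : Measure ℝ),
            (A φ : ℝ → ℂ) =ᵐ[volume] fun s => ∫ t, quantizedDiffKernel f s t * (φ : ℝ → ℂ) t) →
          IsInfiniteOrder A :=
  ⟨fun h f => (h f).2, fun h f => ⟨memLp_quantizedDiffKernel f, h f⟩⟩

end QuantizedDifferential

/-! ## Theorem 4.7 along EVERY orthonormal basis of Sonin's space, for `f = g ∗ g*` — the EQUALITY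
`Σ_j⟨b_j|ϑ(f)b_j⟩ = W_∞(f) + E(f)` (the weak form only had "partial sums ≤") -/

section StrongAutocorr

variable {g : ℝ → ℂ}

/-- RH-FREE. **"`Tr(ϑ(f)𝐒) = Tr(ϑ(f)PP̂P) − Σ λ(n)²⟨ζ_n|ϑ(f)ζ_n⟩`" as an EQUALITY of convergent sums along
EVERY Hilbert basis of `S(1,1)`** (Thm. 4.7 proof, last step, p0018:L77–87), for `f = g ∗ g*` and a
generic «rank-one + projection» decomposition of `PP̂P` (hypotheses (a) `CC2021_prop_2_2_iii`, (b) `hQ`,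
(c) `hA` exactly as in `SoninTraceReduction.sum_re_soninTraceForm_le_of_prop_2_2_iii`): for every
Hilbert basis `(b_j)` of Sonin's space, `HasSum (j ↦ Re⟨b_j|ϑ(f)b_j⟩) (Re L(f) − A)`.  The
Hilbert–Schmidt bookkeeping of `HilbertSchmidtPartialSums.hasSum_norm_sq_adjoint_of_decomposition`
(Reed–Simon I Thm. VI.22: `‖P̂Pϑ(g)‖²_HS = Σ_n μ_n‖ϑ(g)*χ_n‖² + ‖ϑ(g)*𝐒‖²_HS`, Tonelli in `ℝ≥0∞`)
replaces "trace class": every term is `‖ϑ(g)*b_j‖² ≥ 0` (`re_soninTraceForm_autocorr`).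
[cite: ConnesConsani2021, Thm. 4.7 §4 p. 18 (proof, arXiv chunk p0018:L77–87); Prop. 2.2 (iii) p. 10] -/
theorem hasSum_re_soninTraceForm_sonin_of_prop_2_2_iii (h : CC2021_prop_2_2_iii)
    (hg : IsWeilTest g) {ι' : Type*} {χ : ι' → Lp ℂ 2 (volume : Measure ℝ)} {μ : ι' → ℝ}
    (hμ : ∀ n, 0 ≤ μ n)
    (hQ : ∀ x : Lp ℂ 2 (volume : Measure ℝ), HasSum (fun n => μ n * ‖⟪χ n, x⟫_ℂ‖ ^ 2)
      ((⟪x, soninProjection 1 0 (soninProjection 0 1 (soninProjection 1 0 x))⟫_ℂ).re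
        - ‖soninProjection 1 1 x‖ ^ 2))
    {A : ℝ}
    (hA : HasSum (fun n => μ n * (soninTraceForm (weilConv g (weilReflect g)) (χ n)).re) A)
    {ι : Type*} (b : HilbertBasis ι ℂ (soninSpace 1 1)) :
    HasSum (fun j => (soninTraceForm (weilConv g (weilReflect g))
        ((b j : soninSpace 1 1) : Lp ℂ 2 (volume : Measure ℝ))).re)
      ((traceL (weilConv g (weilReflect g))).re - A) := by
  have hgi : Integrable g := hg.1.continuous.integrable_of_hasCompactSupport hg.2
  obtain ⟨w, e, -⟩ := exists_hilbertBasis ℂ (Lp ℂ 2 (volume : Measure ℝ))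
  have hL := hasSum_norm_sq_cutoffs_scalingOp_of_prop_2_2_iii h hg e
  have hL' : HasSum (fun k => RCLike.re ⟪scalingOp g (e k),
      (soninProjection 1 0 ∘L soninProjection 0 1 ∘L soninProjection 1 0) (scalingOp g (e k))⟫_ℂ)
      (traceL (weilConv g (weilReflect g))).re := by
    refine hL.congr_fun fun k => ?_
    rw [RCLike.re_to_complex, ContinuousLinearMap.comp_apply, ContinuousLinearMap.comp_apply,
      re_inner_cutoffSandwich]
  have hQ' : ∀ x, HasSum (fun n => μ n * ‖⟪χ n, x⟫_ℂ‖ ^ 2)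
      (RCLike.re ⟪x, (soninProjection 1 0 ∘L soninProjection 0 1 ∘L soninProjection 1 0) x⟫_ℂ
        - ‖(soninSpace 1 1).starProjection x‖ ^ 2) := fun x => by
    rw [RCLike.re_to_complex]
    exact hQ x
  simp_rw [re_soninTraceForm_autocorr hgi] at hA ⊢
  exact hasSum_norm_sq_adjoint_of_decomposition (V := soninSpace 1 1) b hμ hQ' (scalingOp g) e
    hL' hA

/-- RH-FREE. The same equality with the decomposition (b) supplied by eq. (spectral) of Prop. 4.5 (iii)
(`CC2021_prop_4_5_spectral`, through `SoninTraceReduction.hasSum_sq_inner_prolateZeta_of_prop_4_5_spectral`):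
`Σ_j Re⟨b_j|ϑ(g ∗ g*)b_j⟩ = Re L(g ∗ g*) − A` along every Hilbert basis of `S(1,1)`, whenever
`Σ_n λ(n)² Re⟨ζ_n|ϑ(g ∗ g*)ζ_n⟩ = A`.
[cite: ConnesConsani2021, Thm. 4.7 §4 p. 18 (proof, arXiv chunk p0018:L77–87); Prop. 4.5 (iii) eq. (spectral) p. 17] -/
theorem hasSum_re_soninTraceForm_sonin_of_spectral (h : CC2021_prop_2_2_iii)
    (h' : CC2021_prop_4_5_spectral) (hg : IsWeilTest g) {A : ℝ}
    (hA : HasSum (fun n : ℕ => prolateEigen n ^ 2 *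
      (soninTraceForm (weilConv g (weilReflect g)) (prolateZeta n)).re) A)
    {ι : Type*} (b : HilbertBasis ι ℂ (soninSpace 1 1)) :
    HasSum (fun j => (soninTraceForm (weilConv g (weilReflect g))
        ((b j : soninSpace 1 1) : Lp ℂ 2 (volume : Measure ℝ))).re)
      ((traceL (weilConv g (weilReflect g))).re - A) :=
  hasSum_re_soninTraceForm_sonin_of_prop_2_2_iii h hg (fun n => sq_nonneg (prolateEigen n))
    (hasSum_sq_inner_prolateZeta_of_prop_4_5_spectral h') hA b

/-- RH-FREE. **Theorem 4.7 for `f = g ∗ g*` ALONG EVERY ORTHONORMAL BASIS of `S(1,1)` (real parts,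
equality)**: from `CC2021_prop_2_2_iii`, `CC2021_prop_4_5_spectral`, `CC2021_prop_4_5_ii`,
`CC2021_prop_4_5_iv`, `CC2021_rem_4_6_i`, for every test `g` and every Hilbert basis `(b_j)` of Sonin's
space, `Σ_j Re⟨b_j|ϑ(g ∗ g*)b_j⟩ = Re W_∞(g ∗ g*) + Re E(g ∗ g*)` (`E = evenFunctional (ε ∘ exp)` for THE
prolate family) — the printed "`Tr(ϑ(f)𝐒) = (W_∞ + D)(f) − (D − E)(f)`" with (hA) =
`hasSum_re_soninTraceForm_prolate'`.  The weak form `CC2021_thm_4_7_weak` only asserted "partial sums ≤".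
[cite: ConnesConsani2021, Thm. 4.7 §4 p. 18 (statement (sonine0) and proof, arXiv chunk p0018:L33–87)] -/
theorem hasSum_re_soninTraceForm_sonin (h₂ : CC2021_prop_2_2_iii)
    (h₄ : CC2021_prop_4_5_spectral) (hii : CC2021_prop_4_5_ii) (hiv : CC2021_prop_4_5_iv)
    (h46i : CC2021_rem_4_6_i) (hg : IsWeilTest g) {ι : Type*}
    (b : HilbertBasis ι ℂ (soninSpace 1 1)) :
    HasSum (fun j => (soninTraceForm (weilConv g (weilReflect g))
        ((b j : soninSpace 1 1) : Lp ℂ 2 (volume : Measure ℝ))).re)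
      ((archW (weilConv g (weilReflect g))).re
        + (evenFunctional (epsDensity prolateFun) (weilConv g (weilReflect g))).re) := by
  have hA := hasSum_re_soninTraceForm_prolate' hii hiv h46i hg
  have H := hasSum_re_soninTraceForm_sonin_of_spectral h₂ h₄ hg hA b
  rw [traceL, Complex.add_re] at H
  convert H using 1
  ring

end StrongAutocorr

/-! ## Reality: `W_∞(f)`, `E(f)` and `ε` are real for `f = f*` -/

section Reality

variable {g k : ℝ → ℂ}

/-- `(g*)* = g`. [folklore] -/
private theorem weilReflect_weilReflect' (g : ℝ → ℂ) : weilReflect (weilReflect g) = g := by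
  funext t
  simp [weilReflect]

/-- Convolution on `ℝ` is commutative (`convolution_flip`). [folklore] -/
private theorem weilConv_comm' (f g : ℝ → ℂ) : weilConv f g = weilConv g f := by
  have h := convolution_flip (L := ContinuousLinearMap.mul ℂ ℂ) (μ := (volume : Measure ℝ))
    (f := f) (g := g)
  rw [ContinuousLinearMap.flip_mul] at h
  exact h.symm

/-- `(f ∗ g)* = f* ∗ g*` (substitute `u ↦ −u`; no hypotheses). [folklore] -/
private theorem weilReflect_weilConv' (f g : ℝ → ℂ) :
    weilReflect (weilConv f g) = weilConv (weilReflect f) (weilReflect g) := by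
  funext t
  simp only [weilReflect]
  rw [weilConv_apply, weilConv_apply, ← integral_conj,
    ← integral_neg_eq_self (fun u : ℝ ↦ conj (f u * g (-t - u))) volume]
  refine integral_congr_ae (Eventually.of_forall fun u ↦ ?_)
  simp only [map_mul]
  congr 2
  ring

/-- RH-FREE. `(g ∗ g*)* = g ∗ g*`: autocorrelations are self-adjoint elements of the convolution algebra
(`f ↦ f*`, `f*(t) = conj f(−t)`, is the involution for which `ϑ(f)* = ϑ(f*)`, `adjoint_scalingOp`).
[cite: ConnesConsani2021, Cor. 2.3 (i) §2 p. 11 (proof: "positive for `f = g ∗ g*`")] -/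
theorem weilReflect_autocorr (g : ℝ → ℂ) :
    weilReflect (weilConv g (weilReflect g)) = weilConv g (weilReflect g) := by
  rw [weilReflect_weilConv', weilReflect_weilReflect', weilConv_comm']

/-- RH-FREE. **`W_∞(k)` is real for self-adjoint `k = k*`** (`conj k(−t) = k(t)`): in Bombieri's form
`W_∞(k) = −((log 4π + γ)k(0) + ∫₀^∞ (e^{t/2}(k(t) + k(−t)) − 2k(0))/(2 sinh t) dt)` both `k(0)` and
`k(t) + k(−t) = k(t) + conj k(t)` are real (no convergence needed: `conj` commutes with the integral).
[cite: ConnesConsani2021, Thm. 4.7 §4 p. 18 ("the following functional is positive"); App. B eq. (84) p. 31] -/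
theorem conj_archW_of_weilReflect_eq (hk : weilReflect k = k) : conj (archW k) = archW k := by
  have hk' : ∀ t, conj (k t) = k (-t) := fun t => by
    have := congrFun hk (-t)
    simp only [weilReflect, neg_neg] at this
    exact this
  rw [archW, weilArchTermBombieri]
  simp only [map_neg, map_add, map_mul, ← integral_conj, map_sub, map_div₀, Complex.conj_ofReal,
    map_ofNat]
  have h0 : conj (k 0) = k 0 := by simpa using hk' 0
  rw [h0]
  congr 2
  refine integral_congr_ae (Eventually.of_forall fun t => ?_)
  simp only [hk' t, hk' (-t), neg_neg]
  ring

/-- RH-FREE. **`E(k) = ∫ k(x)G(|x|)dx` is real for self-adjoint `k = k*` and a density `G` real on `[0,∞)`**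
(substitute `x ↦ −x` and conjugate). [cite: ConnesConsani2021, §5 eq. (Eprime) p. 20 (arXiv chunk p0020:L107–110)] -/
theorem conj_evenFunctional_of_weilReflect_eq {G : ℝ → ℂ} (hG : ∀ y, 0 ≤ y → conj (G y) = G y)
    (hk : weilReflect k = k) : conj (evenFunctional G k) = evenFunctional G k := by
  have hk' : ∀ t, conj (k t) = k (-t) := fun t => by
    have := congrFun hk (-t)
    simp only [weilReflect, neg_neg] at this
    exact this
  rw [evenFunctional, ← integral_conj, ← integral_neg_eq_self (fun x : ℝ => k x * G |x|) volume]
  refine integral_congr_ae (Eventually.of_forall fun x => ?_)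
  simp only [map_mul, hk' x, abs_neg, hG |x| (abs_nonneg x)]

/-- RH-FREE. Matrix coefficients `⟨u|ϑ(e^τ)v⟩ = ∫ ū(x)e^{−τ/2}v(e^{−τ}x)dx` of real-valued vectors are real
("the `ξ_n`, `ψ_n` are real valued", Prop. 4.5 (iii)). [cite: ConnesConsani2021, Prop. 4.5 (iii) §4 p. 16 (arXiv chunk p0016:L56)] -/
theorem conj_scalingCoeff_of_real {u v : ℝ → ℂ} (hu : ∀ x, conj (u x) = u x)
    (hv : ∀ x, conj (v x) = v x) (τ : ℝ) : conj (scalingCoeff u v τ) = scalingCoeff u v τ := by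
  rw [scalingCoeff, ← integral_conj]
  refine integral_congr_ae (Eventually.of_forall fun x => ?_)
  simp only [map_mul, Complex.conj_conj, Complex.conj_ofReal, hv]
  rw [hu]

/-- RH-FREE. The terms `τ(n)⟨ξ_n|ϑ(ρ⁻¹)ζ_n⟩` of (sonine0) are real (`ξ_n`, `ζ_n` real valued, `τ(n)` real):
"`ε(ρ)` is the function of `ρ ∈ ℝ₊*`" — a REAL function in print. [cite: ConnesConsani2021, Thm. 4.7 eq. (sonine0) §4 p. 18 (arXiv chunk p0018:L37–40); Prop. 4.5 (iii) p. 16] -/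
theorem conj_epsTerm_prolateFun (n : ℕ) (y : ℝ) :
    conj (epsTerm (prolateFun n) y) = epsTerm (prolateFun n) y := by
  have h := epsTerm_prolateFun (abs_prolateEigen_lt_one n) (-y)
  rw [neg_neg] at h
  rw [h, map_mul, Complex.conj_ofReal, conj_scalingCoeff_of_real]
  · intro x; simp [prolateXiFun]
  · intro x
    simp only [prolateZetaFun, map_mul, Complex.conj_ofReal, conj_prolatePsiFun]

/-- RH-FREE. `ε` (the density `epsDensity prolateFun = ε ∘ exp ∘ |·|`) is real valued.
[cite: ConnesConsani2021, Thm. 4.7 eq. (sonine0) §4 p. 18 (arXiv chunk p0018:L37–40)] -/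
theorem conj_epsDensity_prolateFun (y : ℝ) :
    conj (epsDensity prolateFun y) = epsDensity prolateFun y := by
  rw [epsDensity, Complex.conj_tsum]
  exact tsum_congr fun n => conj_epsTerm_prolateFun n _

/-- RH-FREE. `ε` is real valued, for every even prolate family (there is exactly one:
`prolateFamily_unique`). [cite: ConnesConsani2021, Thm. 4.7 eq. (sonine0) §4 p. 18 (arXiv chunk p0018:L37–40)] -/
theorem conj_epsDensity {ψ : ℕ → ℝ → ℝ} (hψ : ∀ n, IsProlateFunction 1 (2 * n) (ψ n)) (y : ℝ) :
    conj (epsDensity ψ y) = epsDensity ψ y := by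
  rw [prolateFamily_unique hψ isProlateFunction_prolateFun]
  exact conj_epsDensity_prolateFun y

/-- RH-FREE. **`W_∞(g ∗ g*) + E(g ∗ g*)` is real** — the `Im = 0` half of the positivity clause of
Theorem 4.7, UNCONDITIONALLY (`g ∗ g*` is self-adjoint, `W_∞` and `E` are real on self-adjoint test
functions). [cite: ConnesConsani2021, Thm. 4.7 §4 p. 18 ("The following functional is positive", arXiv chunk p0018:L33–36)] -/
theorem im_archW_add_evenFunctional_autocorr {ψ : ℕ → ℝ → ℝ}
    (hψ : ∀ n, IsProlateFunction 1 (2 * n) (ψ n)) (g : ℝ → ℂ) :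
    (archW (weilConv g (weilReflect g))
      + evenFunctional (epsDensity ψ) (weilConv g (weilReflect g))).im = 0 := by
  have h1 := conj_archW_of_weilReflect_eq (weilReflect_autocorr g)
  have h2 := conj_evenFunctional_of_weilReflect_eq (fun y _ => conj_epsDensity hψ y)
    (weilReflect_autocorr g)
  have := Complex.conj_eq_iff_im.1 h1
  have := Complex.conj_eq_iff_im.1 h2
  rw [Complex.add_im]
  linarith

end Reality

/-! ## Theorem 4.7 (i) for `f = g ∗ g*` (complex form) and clause (ii) -/

section StrongAutocorrComplex

variable {g : ℝ → ℂ}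

/-- RH-FREE. **THEOREM 4.7 (i) FOR `f = g ∗ g*`, AS PRINTED (complex form, every orthonormal basis):**
from the five §2/§4 named facts, for every even prolate family `ψ`, every test `g` and every Hilbert basis
`(b_j)` of `S(1,1)`: `HasSum (j ↦ ⟨b_j|ϑ(g ∗ g*)b_j⟩) (W_∞(g ∗ g*) + E(g ∗ g*))` — i.e.
`Tr(ϑ(f)𝐒) = W_∞(f) + ∫ f(ρ⁻¹)ε(ρ)d*ρ` with the trace an honestly convergent, basis-independent sum (each
term `‖ϑ(g)*b_j‖²`; real parts `hasSum_re_soninTraceForm_sonin`, imaginary parts vanish on both sides).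
[cite: ConnesConsani2021, Thm. 4.7 §4 p. 18 (statement (sonine0) and proof, arXiv chunk p0018:L33–87)] -/
theorem hasSum_soninTraceForm_sonin_autocorr (h₂ : CC2021_prop_2_2_iii)
    (h₄ : CC2021_prop_4_5_spectral) (hii : CC2021_prop_4_5_ii) (hiv : CC2021_prop_4_5_iv)
    (h46i : CC2021_rem_4_6_i) {ψ : ℕ → ℝ → ℝ} (hψ : ∀ n, IsProlateFunction 1 (2 * n) (ψ n))
    (hg : IsWeilTest g) {ι : Type*} (b : HilbertBasis ι ℂ (soninSpace 1 1)) :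
    HasSum (fun j => soninTraceForm (weilConv g (weilReflect g))
        ((b j : soninSpace 1 1) : Lp ℂ 2 (volume : Measure ℝ)))
      (archW (weilConv g (weilReflect g))
        + evenFunctional (epsDensity ψ) (weilConv g (weilReflect g))) := by
  have hgi : Integrable g := hg.1.continuous.integrable_of_hasCompactSupport hg.2
  obtain rfl : ψ = prolateFun := prolateFamily_unique hψ isProlateFunction_prolateFun
  have H := hasSum_re_soninTraceForm_sonin h₂ h₄ hii hiv h46i hg b
  rw [Complex.hasSum_iff]
  constructor
  · simpa only [Complex.add_re] using H
  · rw [im_archW_add_evenFunctional_autocorr hψ g]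
    simp only [im_soninTraceForm_autocorr hgi]
    exact hasSum_zero

/-- RH-FREE. **THEOREM 4.7 (ii), the positivity clause — "the following functional is positive" — PROVED
modulo the five §2/§4 named facts:** for `f = g ∗ g*`, `W_∞(f) + E(f)` is real and `≥ 0` (it is the sum of
the non-negative series `Σ_j ‖ϑ(g)*b_j‖²` over any Hilbert basis of `S(1,1)`; reality is unconditional,
`im_archW_add_evenFunctional_autocorr`).  This is exactly the second conjunct of `CC2021_thm_4_7`.
[cite: ConnesConsani2021, Thm. 4.7 §4 p. 18 (statement (sonine0) and proof, arXiv chunk p0018:L33–87)] -/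
theorem archW_add_evenFunctional_autocorr_nonneg (h₂ : CC2021_prop_2_2_iii)
    (h₄ : CC2021_prop_4_5_spectral) (hii : CC2021_prop_4_5_ii) (hiv : CC2021_prop_4_5_iv)
    (h46i : CC2021_rem_4_6_i) {ψ : ℕ → ℝ → ℝ} (hψ : ∀ n, IsProlateFunction 1 (2 * n) (ψ n))
    (hg : IsWeilTest g) :
    0 ≤ (archW (weilConv g (weilReflect g))
          + evenFunctional (epsDensity ψ) (weilConv g (weilReflect g))).re ∧
      (archW (weilConv g (weilReflect g))
          + evenFunctional (epsDensity ψ) (weilConv g (weilReflect g))).im = 0 := by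
  have hgi : Integrable g := hg.1.continuous.integrable_of_hasCompactSupport hg.2
  refine ⟨?_, im_archW_add_evenFunctional_autocorr hψ g⟩
  obtain rfl : ψ = prolateFun := prolateFamily_unique hψ isProlateFunction_prolateFun
  obtain ⟨w, b, -⟩ := exists_hilbertBasis ℂ (soninSpace 1 1)
  have H := hasSum_re_soninTraceForm_sonin h₂ h₄ hii hiv h46i hg b
  rw [Complex.add_re]
  exact H.nonneg fun j => re_soninTraceForm_autocorr_nonneg hgi _

end StrongAutocorrComplex

/-! ## Linearity of the three functionals on test functions -/

section Linearity

variable {k k₁ k₂ : ℝ → ℂ}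

/-- RH-FREE. `⟨ξ|ϑ(f₁ + f₂)ξ⟩ = ⟨ξ|ϑ(f₁)ξ⟩ + ⟨ξ|ϑ(f₂)ξ⟩` for `L¹` test functions and `ξ ∈ L²(ℝ)` (the
coefficient `τ ↦ ⟨ξ|ϑ(e^τ)ξ⟩` is bounded and continuous, `integrable_mul_scalingCoeff`).
[cite: ConnesConsani2021, Prop. 2.2 (iii) §2 p. 10 (proof: `ϑ(f) = ∫ f(λ)ϑ(λ)d*λ` is linear in `f`)] -/
theorem soninTraceForm_add (h₁ : Integrable k₁) (h₂ : Integrable k₂)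
    (ξ : Lp ℂ 2 (volume : Measure ℝ)) :
    soninTraceForm (k₁ + k₂) ξ = soninTraceForm k₁ ξ + soninTraceForm k₂ ξ := by
  rw [soninTraceForm, soninTraceForm, soninTraceForm,
    ← integral_add (integrable_mul_scalingCoeff h₁ ξ ξ) (integrable_mul_scalingCoeff h₂ ξ ξ)]
  refine integral_congr_ae (Eventually.of_forall fun τ => ?_)
  simp only [Pi.add_apply]
  ring

/-- RH-FREE. `⟨ξ|ϑ(c f)ξ⟩ = c⟨ξ|ϑ(f)ξ⟩`. [cite: ConnesConsani2021, Prop. 2.2 (iii) §2 p. 10 (proof)] -/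
theorem soninTraceForm_smul_left (c : ℂ) (k ξ : ℝ → ℂ) :
    soninTraceForm (c • k) ξ = c * soninTraceForm k ξ := by
  rw [soninTraceForm, soninTraceForm, ← integral_const_mul]
  refine integral_congr_ae (Eventually.of_forall fun τ => ?_)
  simp only [Pi.smul_apply, smul_eq_mul]
  ring

/-- RH-FREE. **`W_∞` is additive on test functions** (Bombieri's integrand
`(e^{t/2}(k(t)+k(−t)) − 2k(0))/(2 sinh t)` is integrable on `(0,∞)` for every test `k`:
`WeilArchParity.integrableOn_bombieriIntegrand_weilSymm`). [cite: ConnesConsani2021, Thm. 4.7 §4 p. 18 ("functional"); App. B p. 31] -/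
theorem archW_add (h₁ : IsWeilTest k₁) (h₂ : IsWeilTest k₂) :
    archW (k₁ + k₂) = archW k₁ + archW k₂ := by
  rw [archW, archW, archW, weilArchTermBombieri, weilArchTermBombieri, weilArchTermBombieri,
    ← sub_eq_zero]
  have H := integral_add (WeilArchParity.integrableOn_bombieriIntegrand_weilSymm h₁)
    (WeilArchParity.integrableOn_bombieriIntegrand_weilSymm h₂)
  have H' : (∫ t in Ioi (0:ℝ), ((Real.exp (t / 2) : ℂ) * ((k₁ + k₂) t + (k₁ + k₂) (-t))
      - 2 * (k₁ + k₂) 0) / (2 * Real.sinh t : ℂ)) =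
      (∫ t in Ioi (0:ℝ), ((Real.exp (t / 2) : ℂ) * (k₁ t + k₁ (-t)) - 2 * k₁ 0) /
        (2 * Real.sinh t : ℂ)) +
      ∫ t in Ioi (0:ℝ), ((Real.exp (t / 2) : ℂ) * (k₂ t + k₂ (-t)) - 2 * k₂ 0) /
        (2 * Real.sinh t : ℂ) := by
    rw [← H]
    refine integral_congr_ae (Eventually.of_forall fun t => ?_)
    simp only [Pi.add_apply]
    ring
  rw [H']
  simp only [Pi.add_apply]
  ring

/-- RH-FREE. `W_∞(c k) = c W_∞(k)` (unconditional). [cite: ConnesConsani2021, App. B p. 31] -/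
theorem archW_smul (c : ℂ) (k : ℝ → ℂ) : archW (c • k) = c * archW k := by
  rw [archW, archW, weilArchTermBombieri, weilArchTermBombieri]
  have H' : (∫ t in Ioi (0:ℝ), ((Real.exp (t / 2) : ℂ) * ((c • k) t + (c • k) (-t))
      - 2 * (c • k) 0) / (2 * Real.sinh t : ℂ)) =
      c * ∫ t in Ioi (0:ℝ), ((Real.exp (t / 2) : ℂ) * (k t + k (-t)) - 2 * k 0) /
        (2 * Real.sinh t : ℂ) := by
    rw [← integral_const_mul]
    refine integral_congr_ae (Eventually.of_forall fun t => ?_)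
    simp only [Pi.smul_apply, smul_eq_mul]
    ring
  rw [H']
  simp only [Pi.smul_apply, smul_eq_mul]
  ring

/-- RH-FREE. `E(k₁ + k₂) = E(k₁) + E(k₂)` whenever both integrands `k_i(x)G(|x|)` are integrable.
[cite: ConnesConsani2021, §5 eq. (Eprime) p. 20 (arXiv chunk p0020:L107–110)] -/
theorem evenFunctional_add {G : ℝ → ℂ} (h₁ : Integrable fun x => k₁ x * G |x|)
    (h₂ : Integrable fun x => k₂ x * G |x|) :
    evenFunctional G (k₁ + k₂) = evenFunctional G k₁ + evenFunctional G k₂ := by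
  rw [evenFunctional, evenFunctional, evenFunctional, ← integral_add h₁ h₂]
  refine integral_congr_ae (Eventually.of_forall fun x => ?_)
  simp only [Pi.add_apply]
  ring

/-- RH-FREE. `E(c k) = c E(k)` (unconditional). [cite: ConnesConsani2021, §5 eq. (Eprime) p. 20] -/
theorem evenFunctional_smul {G : ℝ → ℂ} (c : ℂ) (k : ℝ → ℂ) :
    evenFunctional G (c • k) = c * evenFunctional G k := by
  rw [evenFunctional, evenFunctional, ← integral_const_mul]
  refine integral_congr_ae (Eventually.of_forall fun x => ?_)
  simp only [Pi.smul_apply, smul_eq_mul]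
  ring

/-- RH-FREE. **`k · (ε ∘ exp ∘ |·|)` is integrable for every test function `k`**, from (chirem3) in its
symmetric form `δ(e^t) − ε(e^{|t|}) = Σ_n μ_n⟨χ_n|ϑ(e^t)χ_n⟩` (`Σ|μ_n|‖χ_n‖² < ∞`): `ε ∘ exp = δ ∘ exp − Σ`
with `δ ∘ exp ∈ L¹` (`integrable_traceRemainder_exp`, seat t1) and `Σ` bounded continuous
(`continuous_tsum_scalingCoeff`).  (The integrability half of `hasSum_soninTraceForm_of_chirem3`.)
[cite: ConnesConsani2021, Thm. 4.7 proof §4 p. 18 (arXiv chunk p0018:L75–77); App. F Lemma F.1 (= arXiv Lemma 49)] -/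
theorem integrable_mul_epsDensity_abs_of_chirem3 {ψ : ℕ → ℝ → ℝ} {ι : Type*} [Countable ι]
    {μ : ι → ℝ} {χ : ι → Lp ℂ 2 (volume : Measure ℝ)}
    (hs : Summable fun n => |μ n| * ‖χ n‖ ^ 2)
    (h3 : ∀ t : ℝ, HasSum (fun n => (μ n : ℂ) * scalingCoeff (χ n) (χ n) t)
      ((traceRemainder (Real.exp t) : ℂ) - epsDensity ψ t))
    (hk : IsWeilTest k) :
    Integrable fun t => k t * epsDensity ψ |t| := by
  have hkc : Continuous k := hk.1.continuous
  have hki : Integrable k := hkc.integrable_of_hasCompactSupport hk.2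
  obtain ⟨C, hC⟩ := hkc.bounded_above_of_compact_support hk.2
  have hbd : ∀ n t, ‖(μ n : ℂ) * scalingCoeff (χ n) (χ n) t‖ ≤ |μ n| * ‖χ n‖ ^ 2 := fun n t => by
    rw [norm_mul, Complex.norm_real, Real.norm_eq_abs, sq]
    exact mul_le_mul_of_nonneg_left (norm_scalingCoeff_le _ _ _) (abs_nonneg _)
  have hδi : Integrable fun t => k t * (traceRemainder (Real.exp t) : ℂ) :=
    (integrable_traceRemainder_exp.ofReal).bdd_mul hkc.aestronglyMeasurable
      (Eventually.of_forall hC)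
  have hSc := continuous_tsum_scalingCoeff hs
  have hSi : Integrable fun t => k t * ∑' n, (μ n : ℂ) * scalingCoeff (χ n) (χ n) t :=
    hki.mul_bdd hSc.aestronglyMeasurable (c := ∑' n, |μ n| * ‖χ n‖ ^ 2)
      (Eventually.of_forall fun t => tsum_of_norm_bounded hs.hasSum fun n => hbd n t)
  have hεeq : ∀ t : ℝ, epsDensity ψ |t| =
      (traceRemainder (Real.exp t) : ℂ) - ∑' n, (μ n : ℂ) * scalingCoeff (χ n) (χ n) t := fun t => by
    rw [epsDensity_abs, (h3 t).tsum_eq]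
    ring
  refine (hδi.sub hSi).congr (Eventually.of_forall fun t => ?_)
  simp only [Pi.sub_apply, hεeq]
  ring

/-- RH-FREE. `k · (ε ∘ exp ∘ |·|)` is integrable for every test `k`, for THE prolate family, from the three
named facts `CC2021_prop_4_5_ii`, `CC2021_prop_4_5_iv`, `CC2021_rem_4_6_i` (through `hasSum_chirem3_prolate'`).
[cite: ConnesConsani2021, Thm. 4.7 proof §4 p. 18 (arXiv chunk p0018:L75–77)] -/
theorem integrable_mul_epsDensity_abs (hii : CC2021_prop_4_5_ii) (hiv : CC2021_prop_4_5_iv)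
    (h46i : CC2021_rem_4_6_i) (hk : IsWeilTest k) :
    Integrable fun t => k t * epsDensity prolateFun |t| := by
  have hs : Summable fun n : ℕ => |prolateEigen n ^ 2| * ‖prolateZeta n‖ ^ 2 := by
    refine h46i.summable.congr fun n => ?_
    rw [norm_prolateZeta_eq_one n, abs_of_nonneg (sq_nonneg _)]
    ring
  exact integrable_mul_epsDensity_abs_of_chirem3 hs (hasSum_chirem3_prolate' hii hiv h46i) hk

end Linearity

/-! ## The trace identity is linear in the test function -/

section Span

variable {ψ : ℕ → ℝ → ℝ}

/-- RH-FREE. **The trace identity of Theorem 4.7 (i) is additive in the test function**: if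
`Σ_j⟨b_j|ϑ(F_i)b_j⟩ = W_∞(F_i) + E(F_i)` (as `HasSum`s along the Hilbert basis `b` of `S(1,1)`) for the
test functions `F₁, F₂`, then the same holds for `F₁ + F₂` (`ϑ`, `W_∞`, `E` are linear; `E`'s integrand
is integrable by `integrable_mul_epsDensity_abs`). [cite: ConnesConsani2021, Thm. 4.7 §4 p. 18 (statement (sonine0) and proof, arXiv chunk p0018:L33–87)] -/
theorem hasSum_soninTraceForm_sonin_add (hii : CC2021_prop_4_5_ii) (hiv : CC2021_prop_4_5_iv)
    (h46i : CC2021_rem_4_6_i) (hψ : ∀ n, IsProlateFunction 1 (2 * n) (ψ n))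
    {F₁ F₂ : ℝ → ℂ} (hF₁ : IsWeilTest F₁) (hF₂ : IsWeilTest F₂)
    {ι : Type*} {b : HilbertBasis ι ℂ (soninSpace 1 1)}
    (h₁ : HasSum (fun j => soninTraceForm F₁ ((b j : soninSpace 1 1) : Lp ℂ 2 (volume : Measure ℝ)))
      (archW F₁ + evenFunctional (epsDensity ψ) F₁))
    (h₂ : HasSum (fun j => soninTraceForm F₂ ((b j : soninSpace 1 1) : Lp ℂ 2 (volume : Measure ℝ)))
      (archW F₂ + evenFunctional (epsDensity ψ) F₂)) :
    HasSum (fun j => soninTraceForm (F₁ + F₂) ((b j : soninSpace 1 1) : Lp ℂ 2 (volume : Measure ℝ)))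
      (archW (F₁ + F₂) + evenFunctional (epsDensity ψ) (F₁ + F₂)) := by
  obtain rfl : ψ = prolateFun := prolateFamily_unique hψ isProlateFunction_prolateFun
  have i₁ : Integrable F₁ := hF₁.1.continuous.integrable_of_hasCompactSupport hF₁.2
  have i₂ : Integrable F₂ := hF₂.1.continuous.integrable_of_hasCompactSupport hF₂.2
  have H := h₁.add h₂
  have e1 : (fun j => soninTraceForm (F₁ + F₂) ((b j : soninSpace 1 1) : Lp ℂ 2 (volume : Measure ℝ)))
      = fun j => soninTraceForm F₁ ((b j : soninSpace 1 1) : Lp ℂ 2 (volume : Measure ℝ))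
        + soninTraceForm F₂ ((b j : soninSpace 1 1) : Lp ℂ 2 (volume : Measure ℝ)) :=
    funext fun j => soninTraceForm_add i₁ i₂ _
  have e2 : archW (F₁ + F₂) + evenFunctional (epsDensity prolateFun) (F₁ + F₂)
      = (archW F₁ + evenFunctional (epsDensity prolateFun) F₁)
        + (archW F₂ + evenFunctional (epsDensity prolateFun) F₂) := by
    rw [archW_add hF₁ hF₂, evenFunctional_add (integrable_mul_epsDensity_abs hii hiv h46i hF₁)
      (integrable_mul_epsDensity_abs hii hiv h46i hF₂)]
    ring
  rw [e1, e2]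
  exact H

/-- RH-FREE. The trace identity of Theorem 4.7 (i) is homogeneous in the test function (`F ↦ c F`).
[cite: ConnesConsani2021, Thm. 4.7 §4 p. 18 (statement (sonine0) and proof, arXiv chunk p0018:L33–87)] -/
theorem hasSum_soninTraceForm_sonin_smul (c : ℂ) {F : ℝ → ℂ}
    {ι : Type*} {b : HilbertBasis ι ℂ (soninSpace 1 1)}
    (h : HasSum (fun j => soninTraceForm F ((b j : soninSpace 1 1) : Lp ℂ 2 (volume : Measure ℝ)))
      (archW F + evenFunctional (epsDensity ψ) F)) :
    HasSum (fun j => soninTraceForm (c • F) ((b j : soninSpace 1 1) : Lp ℂ 2 (volume : Measure ℝ)))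
      (archW (c • F) + evenFunctional (epsDensity ψ) (c • F)) := by
  have H := h.mul_left c
  have e1 : (fun j => soninTraceForm (c • F) ((b j : soninSpace 1 1) : Lp ℂ 2 (volume : Measure ℝ)))
      = fun j => c * soninTraceForm F ((b j : soninSpace 1 1) : Lp ℂ 2 (volume : Measure ℝ)) :=
    funext fun j => soninTraceForm_smul_left c F _
  have e2 : archW (c • F) + evenFunctional (epsDensity ψ) (c • F)
      = c * (archW F + evenFunctional (epsDensity ψ) F) := by
    rw [archW_smul, evenFunctional_smul]; ring
  rw [e1, e2]
  exact H

end Span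

/-! ## Polarization: `u ∗ K` through four autocorrelations -/

section Polarization

variable {u K : ℝ → ℂ}

/-- `s ↦ a(s)c(t − s)` is integrable for `a` continuous with compact support and `c` continuous (a
convolution integrand). [folklore] -/
private theorem integrable_mul_comp_sub {a c : ℝ → ℂ} (ha : Continuous a)
    (hac : HasCompactSupport a) (hc : Continuous c) (t : ℝ) :
    Integrable fun s => a s * c (t - s) := by
  refine Continuous.integrable_of_hasCompactSupport
    (ha.mul (hc.comp (continuous_const.sub continuous_id))) ?_
  exact hac.mul_right

/-- `g*` is continuous if `g` is. [folklore] -/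
private theorem continuous_weilReflect {f : ℝ → ℂ} (hf : Continuous f) : Continuous (weilReflect f) :=
  Complex.continuous_conj.comp (hf.comp continuous_neg)

/-- `g*` has compact support if `g` has. [folklore] -/
private theorem hasCompactSupport_weilReflect {f : ℝ → ℂ} (hf : HasCompactSupport f) :
    HasCompactSupport (weilReflect f) :=
  (hf.comp_homeomorph (Homeomorph.neg ℝ)).comp_left (g := fun z : ℂ => conj z) (map_zero _)

/-- RH-FREE. **Polarization in the convolution algebra with involution `*`**: for continuous compactly
supported `u, K`, `u ∗ K = ¼[(g₀ ∗ g₀* − g₁ ∗ g₁*) + i(g₂ ∗ g₂* − g₃ ∗ g₃*)]` with `g₀ = u + K*`,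
`g₁ = u − K*`, `g₂ = u + iK*`, `g₃ = u − iK*` (pointwise; the sixteen convolution integrands are
integrable).  This is how "`Tr(ϑ(f)𝐒)`" for a product `f = u ∗ K` reduces to the positive case
`f = g ∗ g*` of the printed proof ("as the trace of a product of two positive operators", Cor. 2.3 (i)).
[cite: ConnesConsani2021, Cor. 2.3 (i) §2 p. 11 (proof); Thm. 4.7 §4 p. 18] -/
theorem weilConv_polarization (hu : Continuous u) (huc : HasCompactSupport u) (hK : Continuous K)
    (hKc : HasCompactSupport K) (t : ℝ) :
    weilConv u K t = (1 / 4 : ℂ) *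
      ((weilConv (u + weilReflect K) (weilReflect (u + weilReflect K)) t
        - weilConv (u - weilReflect K) (weilReflect (u - weilReflect K)) t)
      + I * (weilConv (u + I • weilReflect K) (weilReflect (u + I • weilReflect K)) t
        - weilConv (u - I • weilReflect K) (weilReflect (u - I • weilReflect K)) t)) := by
  have hR : ∀ (f : ℝ → ℂ) (x : ℝ), weilReflect f x = conj (f (-x)) := fun _ _ => rfl
  have hRKc : Continuous (weilReflect K) := continuous_weilReflect hK
  have hRKs : HasCompactSupport (weilReflect K) := hasCompactSupport_weilReflect hKc
  -- the four autocorrelation integrands are integrable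
  have hI : ∀ c : ℂ, Integrable fun s => (u + c • weilReflect K) s *
      weilReflect (u + c • weilReflect K) (t - s) := by
    intro c
    have h1 : Continuous (u + c • weilReflect K) := hu.add (hRKc.const_smul c)
    have h2 : HasCompactSupport (u + c • weilReflect K) :=
      huc.add (hRKs.mono (Function.support_const_smul_subset c _))
    exact integrable_mul_comp_sub h1 h2 (continuous_weilReflect h1) t
  have i0 : Integrable fun s => (u + weilReflect K) s * weilReflect (u + weilReflect K) (t - s) := by
    simpa only [one_smul] using hI 1
  have i1 : Integrable fun s => (u - weilReflect K) s * weilReflect (u - weilReflect K) (t - s) := by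
    simpa only [neg_one_smul, ← sub_eq_add_neg] using hI (-1)
  have i2 := hI I
  have i3 : Integrable fun s => (u - I • weilReflect K) s *
      weilReflect (u - I • weilReflect K) (t - s) := by
    simpa only [neg_smul, ← sub_eq_add_neg] using hI (-I)
  simp only [weilConv_apply]
  rw [← integral_sub i0 i1, ← integral_sub i2 i3, ← integral_const_mul, ← integral_add,
    ← integral_const_mul]
  · refine integral_congr_ae (Eventually.of_forall fun s => ?_)
    simp only [hR, Pi.add_apply, Pi.sub_apply, Pi.smul_apply, smul_eq_mul, map_add, map_sub,
      map_mul, Complex.conj_conj, Complex.conj_I, neg_sub]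
    ring_nf
    simp only [Complex.I_sq]
    ring
  · exact i0.sub i1
  · exact (i2.sub i3).const_mul I

end Polarization

/-! ## Theorem 4.7 (i) on the span of convolutions of test functions -/

section ConvolutionSpan

variable {ψ : ℕ → ℝ → ℝ} {u K : ℝ → ℂ}

/-- Scalar multiples of test functions are test functions. [folklore] -/
private theorem isWeilTest_smul {f : ℝ → ℂ} (hf : IsWeilTest f) (c : ℂ) : IsWeilTest (c • f) :=
  hf.const_mul c

/-- Differences of test functions are test functions. [folklore] -/
private theorem isWeilTest_sub {f g : ℝ → ℂ} (hf : IsWeilTest f) (hg : IsWeilTest g) :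
    IsWeilTest (f - g) :=
  ⟨hf.1.sub hg.1, hf.2.sub hg.2⟩

/-- `0` is a test function. [folklore] -/
private theorem isWeilTest_zero : IsWeilTest (0 : ℝ → ℂ) :=
  ⟨contDiff_const, HasCompactSupport.zero⟩

/-- Finite sums of test functions are test functions. [folklore] -/
private theorem isWeilTest_sum {ι : Type*} (s : Finset ι) {F : ι → ℝ → ℂ}
    (hF : ∀ j ∈ s, IsWeilTest (F j)) : IsWeilTest (∑ j ∈ s, F j) := by
  classical
  induction s using Finset.induction_on with
  | empty => simpa using isWeilTest_zero
  | insert a s ha ih =>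
    rw [Finset.sum_insert ha]
    exact (hF a (Finset.mem_insert_self a s)).add
      (ih fun j hj => hF j (Finset.mem_insert_of_mem hj))

/-- RH-FREE. The trace identity of Theorem 4.7 (i) passes to differences of test functions.
[cite: ConnesConsani2021, Thm. 4.7 §4 p. 18 (statement (sonine0) and proof, arXiv chunk p0018:L33–87)] -/
theorem hasSum_soninTraceForm_sonin_sub (hii : CC2021_prop_4_5_ii) (hiv : CC2021_prop_4_5_iv)
    (h46i : CC2021_rem_4_6_i) (hψ : ∀ n, IsProlateFunction 1 (2 * n) (ψ n))
    {F₁ F₂ : ℝ → ℂ} (hF₁ : IsWeilTest F₁) (hF₂ : IsWeilTest F₂)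
    {ι : Type*} {b : HilbertBasis ι ℂ (soninSpace 1 1)}
    (h₁ : HasSum (fun j => soninTraceForm F₁ ((b j : soninSpace 1 1) : Lp ℂ 2 (volume : Measure ℝ)))
      (archW F₁ + evenFunctional (epsDensity ψ) F₁))
    (h₂ : HasSum (fun j => soninTraceForm F₂ ((b j : soninSpace 1 1) : Lp ℂ 2 (volume : Measure ℝ)))
      (archW F₂ + evenFunctional (epsDensity ψ) F₂)) :
    HasSum (fun j => soninTraceForm (F₁ - F₂) ((b j : soninSpace 1 1) : Lp ℂ 2 (volume : Measure ℝ)))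
      (archW (F₁ - F₂) + evenFunctional (epsDensity ψ) (F₁ - F₂)) := by
  have H := hasSum_soninTraceForm_sonin_add hii hiv h46i hψ hF₁ (isWeilTest_smul hF₂ (-1)) h₁
    (hasSum_soninTraceForm_sonin_smul (-1) h₂)
  have e : F₁ + (-1 : ℂ) • F₂ = F₁ - F₂ := by
    funext t; simp only [Pi.add_apply, Pi.smul_apply, smul_eq_mul, Pi.sub_apply]; ring
  rwa [e] at H

/-- RH-FREE. The trace identity of Theorem 4.7 (i) for `f = 0` (`ϑ(0) = 0`, `W_∞(0) = E(0) = 0`).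
[cite: ConnesConsani2021, Thm. 4.7 §4 p. 18 (statement (sonine0) and proof, arXiv chunk p0018:L33–87)] -/
theorem hasSum_soninTraceForm_sonin_zero (ψ : ℕ → ℝ → ℝ) {ι : Type*}
    (b : HilbertBasis ι ℂ (soninSpace 1 1)) :
    HasSum (fun j => soninTraceForm (0 : ℝ → ℂ) ((b j : soninSpace 1 1) : Lp ℂ 2 (volume : Measure ℝ)))
      (archW (0 : ℝ → ℂ) + evenFunctional (epsDensity ψ) 0) := by
  have e1 : ∀ ξ : ℝ → ℂ, soninTraceForm (0 : ℝ → ℂ) ξ = 0 := fun ξ => by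
    simp [soninTraceForm]
  have e2 : archW (0 : ℝ → ℂ) = 0 := by
    simp [archW, weilArchTermBombieri]
  have e3 : evenFunctional (epsDensity ψ) (0 : ℝ → ℂ) = 0 := by
    simp [evenFunctional]
  simp only [e1, e2, e3, add_zero]
  exact hasSum_zero

/-- RH-FREE. **THEOREM 4.7 (i) FOR A PRODUCT `f = u ∗ K` of test functions, every orthonormal basis**:
`Σ_j ⟨b_j|ϑ(u ∗ K)b_j⟩ = W_∞(u ∗ K) + E(u ∗ K)` as a `HasSum` along every Hilbert basis of `S(1,1)`, from the
five §2/§4 named facts — by `weilConv_polarization` from the four autocorrelations `g_k ∗ g_k*`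
(`hasSum_soninTraceForm_sonin_autocorr`) and linearity.  (Equivalently: `𝐒ϑ(u ∗ K)𝐒 = (𝐒ϑ(u))(ϑ(K)𝐒)` is a
product of two Hilbert–Schmidt operators, so its diagonal sums converge absolutely on every basis.)
[cite: ConnesConsani2021, Thm. 4.7 §4 p. 18 (statement (sonine0) and proof, arXiv chunk p0018:L33–87)] -/
theorem hasSum_soninTraceForm_sonin_weilConv (h₂ : CC2021_prop_2_2_iii)
    (h₄ : CC2021_prop_4_5_spectral) (hii : CC2021_prop_4_5_ii) (hiv : CC2021_prop_4_5_iv)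
    (h46i : CC2021_rem_4_6_i) (hψ : ∀ n, IsProlateFunction 1 (2 * n) (ψ n))
    (hu : IsWeilTest u) (hK : IsWeilTest K) {ι : Type*} (b : HilbertBasis ι ℂ (soninSpace 1 1)) :
    HasSum (fun j => soninTraceForm (weilConv u K) ((b j : soninSpace 1 1) : Lp ℂ 2 (volume : Measure ℝ)))
      (archW (weilConv u K) + evenFunctional (epsDensity ψ) (weilConv u K)) := by
  have hR : IsWeilTest (weilReflect K) := hK.weilReflect
  have hg₀ : IsWeilTest (u + weilReflect K) := hu.add hR
  have hg₁ : IsWeilTest (u - weilReflect K) := isWeilTest_sub hu hR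
  have hg₂ : IsWeilTest (u + I • weilReflect K) := hu.add (isWeilTest_smul hR I)
  have hg₃ : IsWeilTest (u - I • weilReflect K) := isWeilTest_sub hu (isWeilTest_smul hR I)
  -- the four autocorrelations
  have a₀ := hasSum_soninTraceForm_sonin_autocorr h₂ h₄ hii hiv h46i hψ hg₀ b
  have a₁ := hasSum_soninTraceForm_sonin_autocorr h₂ h₄ hii hiv h46i hψ hg₁ b
  have a₂ := hasSum_soninTraceForm_sonin_autocorr h₂ h₄ hii hiv h46i hψ hg₂ b
  have a₃ := hasSum_soninTraceForm_sonin_autocorr h₂ h₄ hii hiv h46i hψ hg₃ b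
  -- their combination
  have d₀₁ := hasSum_soninTraceForm_sonin_sub hii hiv h46i hψ (hg₀.weilConv hg₀.weilReflect)
    (hg₁.weilConv hg₁.weilReflect) a₀ a₁
  have d₂₃ := hasSum_soninTraceForm_sonin_sub hii hiv h46i hψ (hg₂.weilConv hg₂.weilReflect)
    (hg₃.weilConv hg₃.weilReflect) a₂ a₃
  have hsum := hasSum_soninTraceForm_sonin_add hii hiv h46i hψ
    (isWeilTest_sub (hg₀.weilConv hg₀.weilReflect) (hg₁.weilConv hg₁.weilReflect))
    (isWeilTest_smul (isWeilTest_sub (hg₂.weilConv hg₂.weilReflect)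
      (hg₃.weilConv hg₃.weilReflect)) I)
    d₀₁ (hasSum_soninTraceForm_sonin_smul I d₂₃)
  have H := hasSum_soninTraceForm_sonin_smul (1 / 4 : ℂ) hsum
  -- the polarization identity, as an identity of functions
  have e : (1 / 4 : ℂ) • ((weilConv (u + weilReflect K) (weilReflect (u + weilReflect K))
        - weilConv (u - weilReflect K) (weilReflect (u - weilReflect K)))
      + I • (weilConv (u + I • weilReflect K) (weilReflect (u + I • weilReflect K))
        - weilConv (u - I • weilReflect K) (weilReflect (u - I • weilReflect K)))) = weilConv u K := by
    funext t
    rw [weilConv_polarization hu.1.continuous hu.2 hK.1.continuous hK.2 t]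
    simp only [Pi.smul_apply, Pi.add_apply, Pi.sub_apply, smul_eq_mul]
  rwa [e] at H

/-- RH-FREE. **THEOREM 4.7 (i) ON THE SPAN OF CONVOLUTIONS OF TEST FUNCTIONS**: for
`f = Σ_{j∈s} u_j ∗ K_j` (`u_j`, `K_j` test functions), `Σ_i ⟨b_i|ϑ(f)b_i⟩ = W_∞(f) + E(f)` along every
Hilbert basis of `S(1,1)`, from the five §2/§4 named facts.  By the theorem of Dixmier–Malliavin
(every test function on a Lie group — here `ℝ` — is such a finite sum) this span is ALL of `C_c^∞(ℝ)`;
see `CC2021_thm_4_7_of_sec2_sec4_of_factorization`. [cite: ConnesConsani2021, Thm. 4.7 §4 p. 18 (statement (sonine0) and proof, arXiv chunk p0018:L33–87)]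
[cite: DixmierMalliavin1978, Thm. 3.1] -/
theorem hasSum_soninTraceForm_sonin_sum_weilConv (h₂ : CC2021_prop_2_2_iii)
    (h₄ : CC2021_prop_4_5_spectral) (hii : CC2021_prop_4_5_ii) (hiv : CC2021_prop_4_5_iv)
    (h46i : CC2021_rem_4_6_i) (hψ : ∀ n, IsProlateFunction 1 (2 * n) (ψ n))
    {κ : Type*} (s : Finset κ) {u K : κ → ℝ → ℂ} (hu : ∀ j ∈ s, IsWeilTest (u j))
    (hK : ∀ j ∈ s, IsWeilTest (K j)) {ι : Type*} (b : HilbertBasis ι ℂ (soninSpace 1 1)) :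
    HasSum (fun i => soninTraceForm (∑ j ∈ s, weilConv (u j) (K j))
        ((b i : soninSpace 1 1) : Lp ℂ 2 (volume : Measure ℝ)))
      (archW (∑ j ∈ s, weilConv (u j) (K j))
        + evenFunctional (epsDensity ψ) (∑ j ∈ s, weilConv (u j) (K j))) := by
  classical
  induction s using Finset.induction_on with
  | empty => simpa using hasSum_soninTraceForm_sonin_zero ψ b
  | insert a s ha ih =>
    rw [Finset.sum_insert ha]
    have hs : IsWeilTest (∑ j ∈ s, weilConv (u j) (K j)) :=
      isWeilTest_sum s fun j hj =>
        (hu j (Finset.mem_insert_of_mem hj)).weilConv (hK j (Finset.mem_insert_of_mem hj))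
    exact hasSum_soninTraceForm_sonin_add hii hiv h46i hψ
      ((hu a (Finset.mem_insert_self a s)).weilConv (hK a (Finset.mem_insert_self a s))) hs
      (hasSum_soninTraceForm_sonin_weilConv h₂ h₄ hii hiv h46i hψ
        (hu a (Finset.mem_insert_self a s)) (hK a (Finset.mem_insert_self a s)) b)
      (ih (fun j hj => hu j (Finset.mem_insert_of_mem hj))
        (fun j hj => hK j (Finset.mem_insert_of_mem hj)))

end ConvolutionSpan

/-! ## Theorem 4.7 AS PRINTED from Prop. 2.2 (iii), §4 and the Dixmier–Malliavin factorization -/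

section StrongForm

/-- RH-FREE. **THEOREM 4.7 AS PRINTED (`CC2021_thm_4_7`: the trace formula along EVERY orthonormal basis of
`S(1,1)` for EVERY test function, and the positivity of the functional) FROM THE FIVE §2/§4 NAMED FACTS OF
ITS PRINTED PROOF AND THE DIXMIER–MALLIAVIN FACTORIZATION FOR `ℝ`.**  Hypothesis `hDM` is, verbatim in the
tree's vocabulary, the theorem of J. Dixmier and P. Malliavin for the Lie group `G = ℝ`: "every test
function `φ` on a real Lie group is a finite sum of convolutions `φ_i ∗ ψ_i` where `φ_i, ψ_i` are test
functions" ([DixmierMalliavin1978, Thm. 3.1]; restated with proof in [Hegde2021, Thm. 18 and §§3.1–3.3],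
for `G = ℝ` two summands `φ = f ∗ Φ − h ∗ φ`).  It enters as an explicit HYPOTHESIS (no named fact is
introduced; precedent `Literature/Analysis/Fourier/BeurlingMalliavinMultiplier.lean`): it is the one input
of this discharge that is neither in Mathlib nor in the tree.  With it: clause (i) is
`hasSum_soninTraceForm_sonin_sum_weilConv`, clause (ii) is `archW_add_evenFunctional_autocorr_nonneg`.  No
trace-class theory is used (positivity + Hilbert–Schmidt sums + polarization), and nothing about RH.
[cite: ConnesConsani2021, Thm. 4.7 §4 p. 18 (statement (sonine0) and proof, arXiv chunk p0018:L33–87)]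
[cite: DixmierMalliavin1978, Thm. 3.1] [cite: Hegde2021, Thm. 18 (§3.3) and §3.1] -/
theorem CC2021_thm_4_7_of_sec2_sec4_of_factorization
    (hDM : ∀ F : ℝ → ℂ, IsWeilTest F → ∃ (n : ℕ) (u K : Fin n → ℝ → ℂ),
      (∀ j, IsWeilTest (u j)) ∧ (∀ j, IsWeilTest (K j)) ∧ F = ∑ j, weilConv (u j) (K j))
    (h₂ : CC2021_prop_2_2_iii) (h₄ : CC2021_prop_4_5_spectral) (hii : CC2021_prop_4_5_ii)
    (hiv : CC2021_prop_4_5_iv) (h46i : CC2021_rem_4_6_i) : CC2021_thm_4_7 := by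
  intro ψ hψ F hF
  refine ⟨fun ι b => ?_, archW_add_evenFunctional_autocorr_nonneg h₂ h₄ hii hiv h46i hψ hF⟩
  obtain ⟨n, u, K, hu, hK, rfl⟩ := hDM F hF
  exact hasSum_soninTraceForm_sonin_sum_weilConv h₂ h₄ hii hiv h46i hψ Finset.univ
    (fun j _ => hu j) (fun j _ => hK j) b

/-- RH-FREE. **THEOREM 4.7 AS PRINTED FROM THE TWO BOUNDARY FACTS OF RECORD + DIXMIER–MALLIAVIN(`ℝ`)**:
`CC2021_prop_2_2_iii` (Prop. 2.2 (iii)) and `CC2021_sec4_xi_complete` (completeness of the even prolate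
basis, [Slepian]) — the other §4 inputs being row O12's reductions (`ProlateTraceIdentities.lean`) and seat
t3's `CC2021_prop_4_5_iv_holds` — together with the Dixmier–Malliavin factorization hypothesis `hDM` of
`CC2021_thm_4_7_of_sec2_sec4_of_factorization`.  So the strong named fact `CC2021_thm_4_7` rests on exactly
the boundary of route item K1 (`CC2021_thm_4_7_weak_of_prop_2_2_iii_of_xi_complete`) plus one classical
theorem of analysis. [cite: ConnesConsani2021, Thm. 4.7 §4 p. 18 (statement (sonine0) and proof, arXiv chunk p0018:L33–87)]
[cite: DixmierMalliavin1978, Thm. 3.1] -/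
theorem CC2021_thm_4_7_of_prop_2_2_iii_of_xi_complete_of_factorization
    (hDM : ∀ F : ℝ → ℂ, IsWeilTest F → ∃ (n : ℕ) (u K : Fin n → ℝ → ℂ),
      (∀ j, IsWeilTest (u j)) ∧ (∀ j, IsWeilTest (K j)) ∧ F = ∑ j, weilConv (u j) (K j))
    (h₂ : CC2021_prop_2_2_iii) (hξ : CC2021_sec4_xi_complete) : CC2021_thm_4_7 :=
  CC2021_thm_4_7_of_sec2_sec4_of_factorization hDM h₂ (CC2021_prop_4_5_spectral_of_xi_complete hξ)
    (CC2021_prop_4_5_ii_of_xi_complete hξ) CC2021_prop_4_5_iv_holds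
    (CC2021_rem_4_6_i_of_xi_complete hξ)

end StrongForm


/-! ## After `CC2021_sec4_xi_complete_holds`: Theorem 4.7 (weak and strong) modulo `CC2021_prop_2_2_iii` alone -/

section OneFact

variable {g : ℝ → ℂ}

/-- RH-FREE. **THEOREM 4.7, WEAK FORM (`CC2021_thm_4_7_weak` = route item K1 `SoninTraceFormula`) FROM ONE
NAMED FACT, `CC2021_prop_2_2_iii`** (Prop. 2.2 (iii): `Tr(ϑ(f)PP̂P) = W_∞(f) + ∫f(ρ⁻¹)δ(ρ)d*ρ`): the
completeness of the even prolate basis is now the tree theorem `CC2021_sec4_xi_complete_holds`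
(`ProlateProjectionsCompleteness.lean`, seats t10/t3: Slepian's commutation and the joint diagonalisation),
fed into `CC2021_thm_4_7_weak_of_prop_2_2_iii_of_xi_complete`.
[cite: ConnesConsani2021, Thm. 4.7 §4 p. 18 (statement (sonine0) and proof, arXiv chunk p0018:L33–87)] -/
theorem CC2021_thm_4_7_weak_of_prop_2_2_iii (h₂ : CC2021_prop_2_2_iii) : CC2021_thm_4_7_weak :=
  CC2021_thm_4_7_weak_of_prop_2_2_iii_of_xi_complete h₂ CC2021_sec4_xi_complete_holds

/-- RH-FREE. The (H-TF) binder `hTr` of `MainInequalityAssembly.weilArchPositivity_soninTrace_fine_of_opIneq`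
delivered from the ONE named fact `CC2021_prop_2_2_iii`: eq. (4) from it, a `C²` archimedean density with
`G′(0) = e′ > 0`, the sign-free operator inequality (H-op) on `L²(I)` and `8a₀e′/log 2 < 17`.  RH-FREE;
NOT RH-detecting. [cite: ConnesConsani2021, eq. (4) p. 4; Thm. 4.7 §4 p. 18; Thm. 6.11 §6.7 pp. 28–29] -/
theorem weilArchPositivity_soninTrace_fine_of_prop_2_2_iii_of_opIneq (h₂ : CC2021_prop_2_2_iii)
    {G : ℝ → ℂ} (hGa : IsArchDensity G) {a₀ e' : ℝ} (hG : ContDiff ℝ 2 G) (hGe : deriv G 0 = e')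
    (he' : 0 < e')
    (hpos : ∀ ξ : Lp ℂ 2 (volume.restrict (Icc (-(Real.log 2 / 2)) (Real.log 2 / 2))),
      0 ≤ RCLike.re ⟪ξ, ξ - windowOp (-(Real.log 2 / 2)) (Real.log 2 / 2) (integrableOn_varpi hG _ _) ξ⟫_ℂ
            + a₀ * ‖⟪constVector (-(Real.log 2 / 2)) (Real.log 2 / 2), ξ⟫_ℂ‖ ^ 2)
    (hc : 8 * a₀ * e' / Real.log 2 < 17) :
    WeilArchPositivity_soninTrace_fine :=
  weilArchPositivity_soninTrace_fine_of_thm_4_7_weak_of_opIneq (CC2021_thm_4_7_weak_of_prop_2_2_iii h₂)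
    hGa hG hGe he' hpos hc

/-- RH-FREE. **Theorem 4.7 (i) for `f = g ∗ g*` along every orthonormal basis of `S(1,1)` (complex form),
from `CC2021_prop_2_2_iii` alone.** [cite: ConnesConsani2021, Thm. 4.7 §4 p. 18 (statement (sonine0) and proof, arXiv chunk p0018:L33–87)] -/
theorem hasSum_soninTraceForm_sonin_autocorr' (h₂ : CC2021_prop_2_2_iii) {ψ : ℕ → ℝ → ℝ}
    (hψ : ∀ n, IsProlateFunction 1 (2 * n) (ψ n)) (hg : IsWeilTest g) {ι : Type*}
    (b : HilbertBasis ι ℂ (soninSpace 1 1)) :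
    HasSum (fun j => soninTraceForm (weilConv g (weilReflect g))
        ((b j : soninSpace 1 1) : Lp ℂ 2 (volume : Measure ℝ)))
      (archW (weilConv g (weilReflect g))
        + evenFunctional (epsDensity ψ) (weilConv g (weilReflect g))) :=
  hasSum_soninTraceForm_sonin_autocorr h₂ (CC2021_prop_4_5_spectral_of_xi_complete CC2021_sec4_xi_complete_holds)
    (CC2021_prop_4_5_ii_of_xi_complete CC2021_sec4_xi_complete_holds) CC2021_prop_4_5_iv_holds
    (CC2021_rem_4_6_i_of_xi_complete CC2021_sec4_xi_complete_holds) hψ hg b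

/-- RH-FREE. **Theorem 4.7 (ii) — `W_∞(g ∗ g*) + E(g ∗ g*)` is real and `≥ 0` — from `CC2021_prop_2_2_iii`
alone.** [cite: ConnesConsani2021, Thm. 4.7 §4 p. 18 (statement (sonine0) and proof, arXiv chunk p0018:L33–87)] -/
theorem archW_add_evenFunctional_autocorr_nonneg' (h₂ : CC2021_prop_2_2_iii) {ψ : ℕ → ℝ → ℝ}
    (hψ : ∀ n, IsProlateFunction 1 (2 * n) (ψ n)) (hg : IsWeilTest g) :
    0 ≤ (archW (weilConv g (weilReflect g))
          + evenFunctional (epsDensity ψ) (weilConv g (weilReflect g))).re ∧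
      (archW (weilConv g (weilReflect g))
          + evenFunctional (epsDensity ψ) (weilConv g (weilReflect g))).im = 0 :=
  archW_add_evenFunctional_autocorr_nonneg h₂
    (CC2021_prop_4_5_spectral_of_xi_complete CC2021_sec4_xi_complete_holds)
    (CC2021_prop_4_5_ii_of_xi_complete CC2021_sec4_xi_complete_holds) CC2021_prop_4_5_iv_holds
    (CC2021_rem_4_6_i_of_xi_complete CC2021_sec4_xi_complete_holds) hψ hg

/-- RH-FREE. **THEOREM 4.7 AS PRINTED (`CC2021_thm_4_7`) FROM ONE NAMED FACT OF ITS PRINTED PROOF,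
`CC2021_prop_2_2_iii`, AND THE DIXMIER–MALLIAVIN FACTORIZATION FOR `ℝ`** (hypothesis `hDM`, verbatim the
shape of `CC2021_thm_4_7_of_sec2_sec4_of_factorization`; [DixmierMalliavin1978, Thm. 3.1] for `G = ℝ`).
The §4 inputs are all theorems now (`CC2021_sec4_xi_complete_holds` and row O12's reductions).
[cite: ConnesConsani2021, Thm. 4.7 §4 p. 18 (statement (sonine0) and proof, arXiv chunk p0018:L33–87)]
[cite: DixmierMalliavin1978, Thm. 3.1] -/
theorem CC2021_thm_4_7_of_prop_2_2_iii_of_factorization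
    (hDM : ∀ F : ℝ → ℂ, IsWeilTest F → ∃ (n : ℕ) (u K : Fin n → ℝ → ℂ),
      (∀ j, IsWeilTest (u j)) ∧ (∀ j, IsWeilTest (K j)) ∧ F = ∑ j, weilConv (u j) (K j))
    (h₂ : CC2021_prop_2_2_iii) : CC2021_thm_4_7 :=
  CC2021_thm_4_7_of_prop_2_2_iii_of_xi_complete_of_factorization hDM h₂ CC2021_sec4_xi_complete_holds

end OneFact


/-! ## The factorization hypothesis as the tree's named fact `DixmierMalliavin_real` -/

section DixmierMalliavin

open Literature.Analysis.Convolution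

/-- RH-FREE. The bridge from the named fact `Literature.Analysis.Convolution.DixmierMalliavin_real`
([DixmierMalliavin1978, Thm. 3.1] for `G = ℝ`: every `φ ∈ C_c^∞(ℝ; ℂ)` is a finite sum of convolutions of
`C_c^∞` functions) to the factorization hypothesis `hDM` of `CC2021_thm_4_7_of_sec2_sec4_of_factorization`
(test functions `IsWeilTest = ContDiff ℝ ∞ ∧ HasCompactSupport`, `weilConv = ⋆[mul ℂ ℂ]`, both by `rfl`).
[cite: DixmierMalliavin1978, §3 Thm. 3.1] -/
theorem isWeilTest_factorization_of_dixmierMalliavin (hDM : DixmierMalliavin_real) :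
    ∀ F : ℝ → ℂ, IsWeilTest F → ∃ (n : ℕ) (u K : Fin n → ℝ → ℂ),
      (∀ j, IsWeilTest (u j)) ∧ (∀ j, IsWeilTest (K j)) ∧ F = ∑ j, weilConv (u j) (K j) := by
  intro F hF
  obtain ⟨N, f, ψ, hf, hψ, hFeq⟩ := hDM F hF.1 hF.2
  exact ⟨N, f, ψ, fun j => ⟨(hf j).1, (hf j).2⟩, fun j => ⟨(hψ j).1, (hψ j).2⟩, hFeq⟩

/-- RH-FREE. **THEOREM 4.7 AS PRINTED (`CC2021_thm_4_7`) FROM TWO NAMED FACTS: `CC2021_prop_2_2_iii`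
(Connes–Consani 2021, Prop. 2.2 (iii)) and `DixmierMalliavin_real` (Dixmier–Malliavin 1978, Thm. 3.1 for
`G = ℝ`).**  Everything else in the printed proof of Theorem 4.7 — §4 (Prop. 4.5, Rem. 4.6, the completeness
of the prolate basis), the Hilbert–Schmidt bookkeeping replacing "trace class", the symmetric extension,
termwise integration, polarization — is a theorem of the tree.
[cite: ConnesConsani2021, Thm. 4.7 §4 p. 18 (statement (sonine0) and proof, arXiv chunk p0018:L33–87)]
[cite: DixmierMalliavin1978, §3 Thm. 3.1] -/
theorem CC2021_thm_4_7_of_dixmierMalliavin (hDM : DixmierMalliavin_real)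
    (h₂ : CC2021_prop_2_2_iii) : CC2021_thm_4_7 :=
  CC2021_thm_4_7_of_prop_2_2_iii_of_factorization (isWeilTest_factorization_of_dixmierMalliavin hDM) h₂

end DixmierMalliavin

end Literature.NumberTheory.ConnesConsani2021

end
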